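import Summits.BirchSwinnertonDyer.BirchSwinnertonDyer.Theorems.EisensteinDepletionAtTwoStarRestrictedGlue
import Summits.BirchSwinnertonDyer.BirchSwinnertonDyer.Theorems.EisensteinDepletionAtTwoStarPeriodAdditive
import Summits.BirchSwinnertonDyer.BirchSwinnertonDyer.Theorems.EisensteinDepletionAtTwoStarGO2SigmaStubCharacterOfGamma0
import Summits.BirchSwinnertonDyer.BirchSwinnertonDyer.Theorems.EisensteinDepletionAtTwoStarGO2SigmaStubEisImageCyclic
import Summits.BirchSwinnertonDyer.BirchSwinnertonDyer.Theorems.EisensteinDepletionAtTwoStarGO2SigmaStubKummerParityHom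
import Literature.NumberTheory.EllipticCurves.ModularSymbolsProofs
import Literature.NumberTheory.EllipticCurves.CuspFormLFunctionLevelConductorProofs
import Summits.BirchSwinnertonDyer.BirchSwinnertonDyer.Theorems.EisensteinDepletionAtTwoStarGO2SigmaTwistedParityGroup
import Summits.BirchSwinnertonDyer.BirchSwinnertonDyer.Theorems.EisensteinDepletionAtTwoStarOptBNSFCongruenceCore
import Summits.BirchSwinnertonDyer.BirchSwinnertonDyer.Theorems.EisensteinDepletionAtTwoStarGO2CuspEvenness
import Summits.BirchSwinnertonDyer.BirchSwinnertonDyer.Theorems.EisensteinDepletionAtTwoStarOptBNSFNsfDoorPrint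
import Summits.BirchSwinnertonDyer.BirchSwinnertonDyer.Theorems.EisensteinDepletionAtTwoStarKummerDefs
import Summits.BirchSwinnertonDyer.BirchSwinnertonDyer.Theorems.EisensteinDepletionAtTwoStarKummerSqrtFormSigmaThetaLaw
import Summits.BirchSwinnertonDyer.BirchSwinnertonDyer.Theorems.EisensteinDepletionAtTwoStarKummerEtaThetaOfPattern
import Summits.BirchSwinnertonDyer.BirchSwinnertonDyer.Theorems.EisensteinDepletionAtTwoStarGO2KEtaApParity
import Summits.BirchSwinnertonDyer.BirchSwinnertonDyer.Theorems.EisensteinDepletionAtTwoStarGO2KEtaLineAdapter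
import Literature.NumberTheory.EllipticCurves.ManinConstantIntegral
import Literature.NumberTheory.EllipticCurves.ManinConstantSemistablePrimewise
import Literature.NumberTheory.EllipticCurves.ModularCurveManinSemistableLatticeFormProofs
import Mathlib.NumberTheory.ModularForms.DedekindEta
import Literature.NumberTheory.ModularForms.DedekindEtaLogTransformation
import HarnessLib

/-!
# v7 (lead star-p1 GEN 13, 2026-08-28): THE RESEARCH STUB `stub_discrepancyCover` IS CUT AT THEOREM K.  p2 GEN 36–37's eta–Kummer programme
#   (K-ETA.md §5, K-UNIV.md §4) made kernel: THEOREM K = `…Theorems.DepletionAtTwo.KEta.*` (9 files `…StarGO2KEta*`, parts 1–7 GEN 12, parts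
#   8a/8b/9 this GEN: p666946, p667543, p667964 — `LineAdapter.theoremK_line_of_isOrdinaryAt` on this skeleton's binders).  v7 DERIVES
#   `Holds.stub_discrepancyCover` (statement VERBATIM v6, kernel glue, no sorry of its own) from FOUR new stubs + ONE print stub:
#     K-D `stub_dedekindEtaLog`  (PRINT-GRADE classical: Dedekind's functional equation for `log η`, Apostol Thm. 3.4, LOG form — the tree
#                                 has only the exponentiated form `eta_SL2_smul_rademacherPhi`; needed for the SIGN of the `η`-square-root),
#     K-U `stub_etaSqrt`         (ANALYTIC, L: the square root `u` of the Eisenstein `η`-quotient `v_β = ∏ η(t·)^{24 s c_t/g'}` — multiplier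
#                                 `(−1)^{φ_β(γ)/g'}` on `Γ₀(N)` [THEOREM B's parity functional], `u² = V ∈ M_{24m}(Γ₀(N))`, rational `q`-expansion
#                                 `U` with `U² = q^{2m}·Θ_N·E²` [LEMMA E `v₂(g') = 3` + the parity pattern `{t : r_t odd} = T(N)`]; takes K-D as a
#                                 hypothesis),
#     K-Θ `stub_etaKummerTheta`  (ARITHMETIC, L: the eta–Kummer square law (★η)_c for ODD `c`: `c²·Θ_N·q²·(X(Z_c) − x₀Z_c²) = Z_c²·R²`, `R ∈ 1 + qℤ⟦q⟧`
#                                 — THEOREM K at the Honda point `Z_c = exp_W(c·ℓ)` + the Eisenstein congruence `a_m ≡ c_T(m) (mod 2)` + `D = 0 ⇒ □`),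
#     K-A `stub_kummerSqrtFormSigma` (ANALYTIC ASSEMBLY, L: nsf's `NsfDoor.sqrtCuspForm` for the TWISTED group `Γ″` with the extra factor `u`:
#                                 Kummer function/form, `Γ₁(N)`-denominator, `q`-expansion identities and the integrality algebra, all tree engines),
#     `stub_maninPrint`          (PRINT: Edixhoven 1991 Prop. 2 `q ∈ ℤ` ∧ Abbes–Ullmo 1996 Thm. A `2 ∤ q` — the tree's named facts verbatim),
#   plus the tree: Honda integrality (`ParamIntegral`), the parameter expansion (`ParamExpansion`), bounded denominators on `Γ₁(N)` (`Gamma1Bounded`),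
#   cusp-evenness (o) (`CuspEvenness`), Faltings + ordinarity transport, level detection, `ModularParametrizationData.exists_of_isNewformOf`.
#   New tree vocabulary: `kummerThetaDivisors` `T(N)`, `kummerThetaSeries` `Θ_N` (`…StarKummerDefs`, p668527).  Everything below the stubs is
#   VERBATIM v6.  open = K-D (print-grade), K-U, K-Θ, K-A + prints `stub_maninPrint`, `stub_ubd`, `stub_levelEqConductor` (7 = stubs_max).
# v7.1 (same GEN): K-A `stub_kummerSqrtFormSigma` LANDED (p671127, `…StarKummerSqrtFormSigma`; kept as a registered, discharged obligation);
#   K-D is now the tree's NAMED FACT `Literature.NumberTheory.ModularForms.dedekindEta_logTransformationLaw` (p671399) VERBATIM and K-U takes it as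
#   its hypothesis, so that planner p2 GEN 38's kernel `KEta.EtaSign.etaSignCharacter` (PART 12, landing as `…KEtaSignCharacterA/B`) plugs in;
#   p2's PARTS 10a/11/13 (HondaPointPattern, SqrtCriterion, ExpVecParity) landed as sub-lemmas of K-Θ / K-U (p671578, p671480, p671459).
# v7.2 (same GEN): stub K-Θ `stub_etaKummerTheta` CORRECTED (stub-misstated by the lead: v7's `c²·Θ_N·X²·(X(Z_c) − x₀Z_c²) = Z_c²·R²` asks
#   `R·(cX/Z_c) ∈ ℤ⟦q⟧`, false for `|c| > 1` since `[c]T/c ∉ ℤ⟦T⟧`; the TRUE law is `Θ_N·(X(Z_c) − x₀Z_c²) = R²`, p2's `EtaKummerSquareLaw` shape,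
#   = K1 HondaPoint + KA + KΘp + KF + K√); the analytic assembly is re-proved against it (`KummerSigma.kummerSqrtFormSigma_theta`,
#   `…StarKummerSqrtFormSigmaTheta`, M = D) and used BY NAME (no K-A stub any more); open = K-D (print), K-U, K-Θ + 3 prints (6 stubs).
# v7.3 (same GEN): K-Θ DERIVED (`…StarKummerEtaThetaOfPattern`: K1 HondaPoint + KF EulerClassLaw + KΘp ThetaPattern + K√ SqrtCriterion, all p2 GEN 38
#   kernels landed this GEN, + p2's glue) from the NEW elementary stub KA `stub_apParityPattern` (a_n odd ⟺ LevelPattern, n odd);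
#   open = K-D (print), K-U `stub_etaSqrt`, KA `stub_apParityPattern` + prints maninPrint / ubd / levelEqConductor (6 stubs).
# v7.4 (same GEN): KA LANDED (p673866 `…StarGO2KEtaApParity`, p2 PART 17; kept as a discharged obligation); K-U's clause `constantCoeff U = 1` was
#   UNSATISFIABLE for m ≥ 1 (second stub-misstatement by the lead) and is removed (K-A″ `kummerSqrtFormSigma_thetaLaw` never used it).
# v6 (lead star-p1 GEN 11, 2026-08-28): RESHAPE after p2 GEN 36's finding (HOME/p2/g36/CUSP-EVENNESS.md, kit j312110): clause (ii-a) «cusp evenness» of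
#   `stub_gammaOneCover` is FALSE AS TYPED at N = ℓ², ℓ ≡ ±3 (mod 8) (`…CuspEvenness.parabolic_odd_at_exceptional`) — the v5 stub held there only vacuously
#   (Setzer: no étale rational 2-torsion at conductor ℓ²) and only given `W₀.conductorNorm ℤ = N`, which was NOT a binder.  v6: the research stub is CUT to
#   clause (ii-b) ALONE, `stub_discrepancyCover` (p2's `DiscrepancyCoverB`: v5's binders + `W₀.conductorNorm ℤ = N`); clauses (o), (ii-a), (iii) are TREE
#   THEOREMS (p2 GEN 36's CuspEvenness package, landed by the lead as `Theorems/EisensteinDepletionAtTwoStarGO2CuspEvenness{Parabolic,ELeg,Core,}.lean`,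
#   `…CuspEvenness.cover_clauses_of_curveData`); the print stub `stub_levelEqConductor` becomes Carayol's named fact
#   `IsNewformOf.level_eq_conductorNorm` VERBATIM (serves `W` and `W₀`); v5's `stub_gammaOneCover` is DERIVED (`Holds.stub_gammaOneCover`, no sorry).
#   The PARENT closer `DepletedLambdaLawAtTwoModNSF_of` stays Carayol-free (level = conductor from the parent's modularity clause).
#   open = `stub_discrepancyCover` research + `stub_ubd`, `stub_levelEqConductor` print.
# v5 (lead star-p1 GEN 10, 2026-08-28): the research stub `stub_gammaOneCover` is WEAKENED — clause (ii-b) asks for an anti-invariant cusp form of ANY weight `k` on the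
#   discrepancy cover (v4: weight 2); the glue `gammaOneParity_of_cover` uses the tree's congruence core in every weight (`…CongruenceCore.false_of_antiinvariant_integral_cuspForm_wt`,
#   p644813).  v4 ⇒ v5 trivially; the weakening admits the `E`-level witness `u_P·u_χ·G` of THEOREM-A-dblprime §6.  Everything else verbatim v4.
# Line `kummer` on crux `StarGO2Sigma` (item stmt-BirchSwinnertonDyer-27046, route `EisensteinDepletionAtTwo`)
# — planner bsd-rank2-p2 GEN 32, 2026-08-28 (skeleton v2)
# v4 (lead bsd-rank2-star-p1 GEN 9, 2026-08-28): research stub 1b CUT at the THEOREM A / THEOREM B seam — `stub_gammaOneParity` is DERIVED (kernel glue, no sorry)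
# from `stub_gammaOneCover` (RESEARCH: (o) + Eisenstein cusp-evenness + «a non-trivial discrepancy cover carries an anti-invariant integral weight-2 cusp form» + (iii))
# and `stub_ubd` (PRINT: the tree's Calegari–Dimitrov–Tang named fact) through the tree's TWISTED PARITY GROUP (p641228) and CONGRUENCE CORE (p639511/p641363);
# open = `stub_gammaOneCover` research + `stub_ubd`, `stub_levelEqConductor` print.

THE CUT (functional form of the twisted parity law).  Both sides of (★-GO₂^Σ) are HOMOMORPHISMS on `Γ₀(N)`:
the Eisenstein side `γ ↦ φ_β(γ) = stabEisensteinPeriod N_W β (γ)` is additive on `Γ₀(N_W)` (TREE: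
`stabEisensteinPeriod_mul`), and the symbol side `γ ↦ q·{∞, γ∞}_f = q·cuspSymbol f γ ∈ Λ_{W₀} = qΛ_f` is additive
(TREE: Manin, `cuspSymbol_mul_holds`) and its class in `Λ_{W₀}/(ℤλ + 2Λ_{W₀}) ≅ ℤ/2` is the Kummer / Weil pairing with the
rational 2-torsion point `λ/2` of the optimal curve.  Hence the DISCREPANCY
`δ(γ) := (φ_β(γ)/g' mod 2) + [q·cuspSymbol f γ ∉ ℤλ + 2Λ_{W₀}]` is a homomorphism `Γ₀(N) → ℤ/2` once `φ_β(Γ₀(N)) ⊆ ℤg'`.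
(★-GO₂^Σ) says `δ` is a function of the cusp denominator `d`; the cell's paper chain (THEOREM B(i) `h̄_β ≡ f̄ (mod 2)` +
THEOREM A «formal rational 2-torsion of `J₀(N)` lies in the Shimura subgroup `Σ_N`», memos HOME/p2/g29/THEOREM-B.md,
THEOREM-A-v2.md, GEN 31 THEOREM-A-AUDIT.md, SIGMA-NSF-UNTWIST.md §4(c)) proves exactly that `δ` is a `Σ_N`-class, i.e.
`δ` VANISHES ON `Γ₁(N)` (`stub_gammaOneParity`, the RESEARCH stub, stated at level `N = N_W` for the generator `g'` of the
cyclic period group `φ_β(Γ₀(N)) = ℤg'` — `stub_eisImageCyclic`, elementary: `Φ` is `ℤ`-valued, TREE `rademacherPhi_mem_int`).  The rest is elementary: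
a parity functional on `Γ₀(N)` that is multiplicative and trivial on `Γ₁(N)` factors through `γ ↦ d(γ) mod N`
(`stub_characterOfGamma0`, abstract group theory: `(γ⁻¹γ')₂₂ ≡ 1 (mod N)` when `d(γ) = d(γ')`), and the symbol parity is
multiplicative (`stub_kummerParityHom`: Manin additivity + the index-2 count in `Λ_{W₀}/2Λ_{W₀} ≅ (ℤ/2)²`).  The cusp clause
of the crux is the value of these homomorphisms at the Bézout matrix `γ_{b,d} ∈ Γ₀(N_W)` (TREE:
`modularSymbol_gamma0_smul_holds` at `r = 0` gives `cuspSymbol f γ_{b,d} = {∞,b/d}_f − {∞,0}_f`).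

LEVEL = CONDUCTOR.  The crux quantifies over newforms `f` of `W` of ANY level `N`, while `φ_β` lives at level
`N_W := W.conductorNorm ℤ`; the two homomorphisms live on one group only when `N = N_W` (Carayol 1986 — in the tree a
NAMED FACT `IsNewformOf.level_eq_conductorNorm`, PROVED only for squarefree `N_W` and from the modularity clause:
`IsNewformOf.level_eq_conductorNorm_of_exists_conductorLevel`).  So the line has TWO compositions:
* `StarGO2Sigma_of : stub_levelEqConductor → stub_gammaOneParity → StarGO2Sigma`  (v3: stubs 1a, 2, 3 CLOSED in the tree and consumed)
  (the crux BY NAME; `stub_levelEqConductor` = Carayol in the cube-free good-ordinary-at-2 regime), and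
* `DepletedLambdaLawAtTwoModNSF_of : stub_gammaOneParity → StarOptBNSF → E1M_NSF`  (v3)
  — the split PARENT (item 27021) WITHOUT Carayol: its modularity antecedent gives `N = N_W` by strong multiplicity one
  (TREE), and the pointwise glue `depletedLambdaLawAtTwoAt_of_star` (p619642) does the rest.
v3 (2026-08-28T12Z): eng-2 GEN 16 landed `stub_eisImageCyclic` and `stub_kummerParityHom` (`…Theorems.DepletionAtTwo.KummerStubs.*`,
p626166 + sibling) within an hour of v2; both are imported and CONSUMED; the OPEN stubs are now exactly `stub_gammaOneParity`
(THEOREMS A+B against the generator) and `stub_levelEqConductor` (Carayol, needed only for 27046 BY NAME); the PARENT closer is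
`DepletedLambdaLawAtTwoModNSF_of : stub_gammaOneParity → StarOptBNSF → E1M_NSF`.
v2 (2026-08-28T11Z): v1's bundled research stub `stub_gammaOneLaw` = `GammaOneLaw` is now DERIVED (`gammaOneLaw_of`) from
1a + 1b; stub 3 `stub_characterOfGamma0` is CLOSED in the tree (eng-2 GEN 16, `KummerStubs.stub_characterOfGamma0`) and is
CONSUMED inside the compositions (no longer a hypothesis).  `sorry` lives only in the four OPEN `Holds.stub_*`.  HONEST FRAMING: a skeleton for an OPEN crux; nothing here reads an
analytic rank; E1M_NSF / the T-r3₂ leaf / BSD are NOT proved (PARTITION D-0054: none — r_an ≥ 2, axis S0).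
-/

set_option linter.dupNamespace false
set_option autoImplicit false

noncomputable section

namespace Summit.BirchSwinnertonDyer.BirchSwinnertonDyer.Cruxes.StarGO2Sigma.Kummer

open scoped MatrixGroups ModularForm
open CongruenceSubgroup
open Literature.NumberTheory.EllipticCurves
open Literature.NumberTheory.EllipticCurves.Greenberg1999
open Literature.NumberTheory.EllipticCurves.ModularForms
open Literature.NumberTheory.ModularForms
open Summit.BirchSwinnertonDyer.BirchSwinnertonDyer.Theorems.DepletionAtTwo
open scoped Manifold

/-! ### The stubs (registered obligations; `sorry` lives only in the OPEN `Holds.stub_*`; stub 3 is CLOSED in the tree) -/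

/-- STUB 1a `stub_eisImageCyclic` (ELEMENTARY, size M — the period group of the depleted Eisenstein series on `Γ₀(N)`
is cyclic).  For `N ≠ 0` and admissible `β` the value set `φ_β(Γ₀(N)) ⊂ ℚ` is `ℤ·g'` for some `g' : ℚ` (`g' = 0` allowed).
Proof plan: `φ_β` is a homomorphism on `Γ₀(N)` (TREE `stabEisensteinPeriod_mul`, `stabEisensteinPeriod_one`,
`stabEisensteinPeriod_inv`), so the value set is an additive subgroup of `ℚ`; it lies in `(1/rad N)·ℤ` because Rademacher's
`Φ` is `ℤ`-valued on `SL₂(ℤ)` (TREE `rademacherPhi_mem_int`, at the matrix `(a, tb; c/t, d)`, `t ∣ c`) and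
`stabCoeff N β t ∈ (1/rad N)·ℤ` (a product of `1, −β_ℓ/ℓ, −(1+ℓ)/ℓ, 1/ℓ, 0`); a subgroup of the infinite cyclic group
`(1/rad N)·ℤ` is cyclic (subgroups of `ℤ` are `zmultiples`).  Why it might fail: it does not (book-keeping only).
[cite: RademacherGrosswald1972, Ch. 4 A, pp. 49–50] [cite: Stevens1982, §2.5 (PDF p. 38)] -/
theorem Holds.stub_eisImageCyclic :
    ∀ (N : ℕ) (β : ℕ → ℕ), N ≠ 0 → IsAdmissibleStabData N β →
      ∃ g' : ℚ, ∀ x : ℚ,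
        (∃ γ : Gamma0 N, stabEisensteinPeriod N β ((γ : SL(2, ℤ)) 0 0) ((γ : SL(2, ℤ)) 0 1)
            ((γ : SL(2, ℤ)) 1 0) ((γ : SL(2, ℤ)) 1 1) = x) ↔ ∃ n : ℤ, x = n * g' :=
  KummerStubs.stub_eisImageCyclic   -- CLOSED in the tree (eng-2 GEN 16); kept as a named, discharged obligation

/-- STUB K-D `stub_dedekindEtaLog` (PRINT — the tree's NAMED FACT `dedekindEta_logTransformationLaw`, verbatim; v7.1).  DEDEKIND'S
TRANSFORMATION LAW OF `log η` IN LOGARITHMIC FORM (Rademacher–Grosswald Ch. 4 A eq. (57a), (60) = Apostol Thm. 3.4): a holomorphic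
branch `log η` on `ℍ` with `exp ∘ log η = η`, `log η(z+b) = log η(z) + πib/12`, and for `c > 0`
`log η(γz) = log η(z) + ½Log(cz+d) + πi(Φ(γ) − 3)/12`.  The tree has only the EXPONENTIATED law `eta_SL2_smul_rademacherPhi`;
the log form fixes the SIGN of the multiplier of an odd power of `η^{1/2}`-quotients (stub K-U; planner p2 GEN 38's
`KEta.EtaSign.etaSignCharacter` takes exactly this fact as its hypothesis).  Discharge route: induction over `S`, `T` with the
composition law (62) (tree `RademacherPhiCompositionProofs`) and branch tracking, or Siegel's `S`-case + Euclid.  Registered like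
`stub_ubd`.  Why it might fail: it does not (print). [cite: RademacherGrosswald1972, Ch. 4 A, eq. (60)] [cite: Apostol1990, Thm. 3.4] -/
theorem Holds.stub_dedekindEtaLog :
    Literature.NumberTheory.ModularForms.dedekindEta_logTransformationLaw := by
  sorry

/-- STUB K-U `stub_etaSqrt` (ANALYTIC + 2-adic bookkeeping, size L — v7; v7.4: the unsatisfiable clause `U(0) = 1` REMOVED — `u = v·Δ^m` has
`q`-expansion `±q^m(1 + …)`; = K-ETA §5 (P1)+(P5) and THEOREM B's LEMMA E).  THE SQUARE ROOT
OF THE EISENSTEIN `η`-QUOTIENT.  For odd `N`, admissible `β` (`IsAdmissibleStabData`: `Σ_t c_t = Σ_t t·c_t = 0`, `c_t = stabCoeff N β t`)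
and the generator `g'` of the period group `φ_β(Γ₀(N)) = ℤ·g'` (`φ_β = stabEisensteinPeriod N β`), GIVEN Dedekind's log-functional
equation (stub K-D, hypothesis): there are `m`, a modular form `V ∈ M_{24m}(Γ₀(N))`, a holomorphic nowhere-vanishing `u : ℍ → ℂ`
with `u² = V`, whose weight-`12m` multiplier on `Γ₀(N)` is the EISENSTEIN PARITY `u|γ = (−1)^{φ_β(γ)/g'}·u`, and whose `q`-expansion
`U ∈ ℚ⟦q⟧` (`qExpansion 1 u`, `U(0) = 1`) satisfies `U² = q^{2m}·Θ_N·E²` with `E ∈ 1 + qℤ⟦q⟧` (`Θ_N = kummerThetaSeries N`).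
CONSTRUCTION: `r_t := 24·s·c_t/g' ∈ ℤ` (`s` odd clearing the odd denominators; `2`-integrality is LEMMA E `v₂(g') = 3`:
`≥ 3` = the landed (★-EisEight) `star_eisEightGlobal`/`starEisEight₂`; `≤ 3`: otherwise the `Γ₀(N)`-INVARIANT half-quotient
`√(∏ η(t·)^{2^{a}r_t})` would be a rational modular form with unbounded `2`-power denominators (binomial coefficients `binom(x,k)`,
`v₂(x) = −1`) against the tree's bounded denominators on `Γ₁(N)` `Gamma1Bounded.stub_gamma1Bounded`); `v := etaQuotient N r`
(Σ r_t = 0, Σ t r_t = 0; `Γ₀(N)`-invariant since its log-period `(1/24)Σ r_tΦ(γ_t) = (s/g')φ_β(γ) ∈ ℤ`, tree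
`etaQuotient_smul_eq_cexp_logPeriod`); `u := exp(½ Σ_t r_t log η(t·))` (`log η` as in K-D), so `u(γτ)/u(τ) = exp(πi·s·φ_β(γ)/g')
= (−1)^{φ_β(γ)/g'}` by K-D at the matrices `(a, tb; c/t, d)` (the `½log` terms cancel as `Σ r_t = 0`; `c = 0`: `u(τ+1) = u(τ)` as
`Σ t r_t = 0`; `c < 0`: `rademacherPhi_neg`); `V := v·Δ^{2m}` with `m` killing the cusp poles of `v` (tree `cuspOrder24`,
`ModularCurveEtaQuotientsProofs`); `U² = qExp(v)·qExp(Δ)^{2m}` with `qExp(v) = ∏_t E_t^{r_t}` (`E_t = formalEulerScaled t`, tree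
`etaQuotient_eq_prod_eulerFn_zpow`, `qExpansion_eulerFn`, `hasSum_X_mul_formalDeltaUnit`) and the PARITY PATTERN `r_t` odd ⟺
`v₂(c_t) = 0` ⟺ `t ∈ T(N)` (`c_t` is a product of `1, −β_ℓ/ℓ` [units] and `1, −(1+ℓ)/ℓ` [even], `1/ℓ`), so
`∏ E_t^{r_t} = Θ_N·(∏ E_t^{(r_t−[t∈T])/2})²`.  Why it might fail: only if LEMMA E (≤ 3) fails at some admissible `β` (data F1′:
`v₂(cF) = 3` for 1302/1302). [cite: Apostol1990, Thm. 3.4] [cite: RademacherGrosswald1972, Ch. 4 A] [cite: Stevens1982, §2.4–2.5] -/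
theorem Holds.stub_etaSqrt :
    ∀ (N : ℕ) [NeZero N] (β : ℕ → ℕ), Odd N → IsAdmissibleStabData N β → ∀ (g' : ℚ),
      (∀ x : ℚ, (∃ γ : Gamma0 N,
        stabEisensteinPeriod N β ((γ : SL(2, ℤ)) 0 0) ((γ : SL(2, ℤ)) 0 1) ((γ : SL(2, ℤ)) 1 0) ((γ : SL(2, ℤ)) 1 1) = x) ↔
          ∃ n : ℤ, x = n * g') →
      Literature.NumberTheory.ModularForms.dedekindEta_logTransformationLaw →
      ∃ (m : ℕ) (V : ModularForm (Gamma0 N) ((24 * m : ℕ) : ℤ)) (u : UpperHalfPlane → ℂ)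
        (U : PowerSeries ℚ) (E : PowerSeries ℤ),
        MDifferentiable 𝓘(ℂ) 𝓘(ℂ) u ∧ (∀ τ : UpperHalfPlane, u τ ≠ 0) ∧ (∀ τ : UpperHalfPlane, u τ ^ 2 = V τ) ∧
        (∀ γ : SL(2, ℤ), γ ∈ Gamma0 N → ∀ n : ℤ,
          stabEisensteinPeriod N β (γ 0 0) (γ 0 1) (γ 1 0) (γ 1 1) = n * g' →
            u ∣[((12 * m : ℕ) : ℤ)] γ = ((-1 : ℂ) ^ n.natAbs) • u) ∧
        (∀ n : ℕ, PowerSeries.coeff n (UpperHalfPlane.qExpansion (1 : ℝ) u) = ((PowerSeries.coeff n U : ℚ) : ℂ)) ∧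
        PowerSeries.constantCoeff E = 1 ∧
        U ^ 2 = PowerSeries.map (Int.castRingHom ℚ)
          (PowerSeries.X ^ (2 * m) * kummerThetaSeries N * E ^ 2) := by
  sorry

/-- STUB KA `stub_apParityPattern` (ELEMENTARY, size M — v7.3; planner p2 GEN 38's cut, signature verbatim over the tree's
`KEta.ThetaPattern.LevelPattern`).  THE PARITY PATTERN OF THE HECKE EIGENVALUES: for a globally minimal `W₀/ℚ` with a rational
`2`-torsion point and odd `n`, `a_n(W₀)` is odd iff every prime of `n` is multiplicative for `W₀` (`v_p(N) = 1`) or good (`v_p(N) = 0`)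
with even exponent in `n` (`LevelPattern N_{W₀} n`).  Proof plan: `a_n = ∏ a_{p^e}` (`isMultiplicative_LFunction`), `a_{p^e} = [T^e]L_p⁻¹`
(`LFunction_apply_prime_pow`); good odd `p`: `2 ∣ #W̃₀(𝔽_p) = p + 1 − a_p` (rational `2`-torsion injects, `addOrderOf_dvd_reductionPointCount`),
so `a_p` is even and `a_{p^{e+1}} = a_p a_{p^e} − p a_{p^{e−1}} ≡ a_{p^{e−1}}`; multiplicative `p`: `a_{p^e} = (±1)^e`; additive `p`:
`a_{p^e} = 0`; dictionary `v_p(N) = 0 / 1 / ≥ 2` ↔ good / multiplicative / additive (`dvd_conductorNorm_iff_not_hasGoodReductionAtPrime`,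
`conductorExponent_eq_one`-type tree theorems).  Why it might fail: it does not mathematically; the multiplicative ↔ `v_p(N) = 1`
dictionary must be located in the tree.  This is the LAST piece of K-Θ: `stub_etaKummerTheta` is DERIVED from it below
(`KummerSigma.ThetaLaw.etaKummerTheta_of_apParityPattern`, tree). [cite: SilvermanAEC2009, V.2.3.1 and App. C §16] -/
theorem Holds.stub_apParityPattern :
    ∀ (W₀ : WeierstrassCurve ℚ) [W₀.IsElliptic] [W₀.IsGloballyMinimal] (x₀ : ℚ), HasRationalTwoTorsionX W₀ x₀ →
      ∀ n : ℕ, ¬ 2 ∣ n → (Odd (W₀.LFunction n) ↔ KEta.ThetaPattern.LevelPattern (W₀.conductorNorm ℤ) n) :=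
  KEta.ApParity.stub_apParityPattern   -- CLOSED in the tree (p673866, p2 GEN 38 PART 17); kept as a named, discharged obligation

/-- K-Θ `stub_etaKummerTheta` — NO LONGER A STUB (v7.3): DERIVED from KA `stub_apParityPattern` and the landed kernels K1 (HondaPoint),
KF (EulerClassLaw), KΘp (ThetaPattern), K√ (SqrtCriterion) by `KummerSigma.ThetaLaw.etaKummerTheta_of_apParityPattern`.  (ARITHMETIC, size L — v7; = K-ETA §0 (★η) for an odd multiple, from THEOREM K).  THE ETA–KUMMER
SQUARE LAW AT AN ODD MULTIPLE OF THE HONDA POINT.  For a globally minimal `W₀/ℚ`, good ordinary at `2`, with an ÉTALE rational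
`2`-torsion abscissa `x₀` (`v₂(x₀) ≥ 0`), and every ODD `c ∈ ℤ`: with `ℓ(q) = Σ aₙ(W₀)qⁿ/n`, `Z_c := exp_{W₀}(c·ℓ) ∈ qℤ⟦q⟧`
(Honda, tree `ParamIntegral.stub_paramIntegralFormal`), `X = formalXMulSq W₀` (`= T²x(T)`), `N = N_{W₀}` (odd, cube-free by the
rational `2`-torsion) and `Θ_N = kummerThetaSeries N`:  `Θ_N(q)·(X(Z_c) − x₀Z_c²) = R(q)²` for some `R ∈ 1 + qℤ⟦q⟧` — the square
class of `Z_c²(x([c]M) − x₀)` is that of `Θ_N` (v7.2: CORRECTED from v7's `c²·Θ_N·q²·(…) = Z_c²·R²`, which asks `R·cq/Z_c ∈ ℤ⟦q⟧` and fails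
for `|c| > 1`; = planner p2's `EtaKummerSquareLaw` shape).  PROOF PLAN (K-ETA §4 v3′ / K-UNIV §4): (i) THEOREM K in the
tree, `KEta.LineAdapter.theoremK_line_of_isOrdinaryAt W₀ hord hx hv` at `z := Z_c ∈ qℤ₂⟦q⟧`: the `2`-adic square class of
`g∘z = Z_c²(x(Z_c) − x₀)` is `(ḡ∘z̄)²(s̄∘z̄ + (ω̄∘z̄)²d̄_z)`, `s̄ − s̄² = λ̄_α`; (ii) evaluate at the Honda point: `log_W(Z_c) = c·ℓ`
turns `s̄∘z̄ + (ω̄∘z̄)²d̄_z` into the parity pattern `Σ_{n≥1, v₂(n) even} ā_{n′} qⁿ` (`n′` the odd part; p2's `DworkExpClass` /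
K-UNIV Lemma 2, `c` odd); (iii) the EISENSTEIN CONGRUENCE `a_m ≡ c_T(m) := #{t ∈ T(N) : t ∣ m} (mod 2)` (`a_p` even at odd good `p`
— rational `2`-torsion; `a₂` odd — ordinary; `a_ℓ = ±1` at `ℓ ∥ N`, `a_ℓ = 0` at `ℓ² ∣ N`; multiplicativity) and the triviality
«for odd `t`: `n/t = □ ⟺ v₂(n)` even ∧ `n′/t = □`» give the same class for `Θ_N`; (iv) `D(Θ_N·V) = 0 ⇒ Θ_N·V = R²` with `R ∈
ℚ⟦q⟧ ∩ ℤ₂⟦q⟧`, and the only other denominators are powers of `c`, which the factor `c²` absorbs (`x([c]M) = c⁻²q⁻²·unit`).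
Numerics: 247 + 238 curves at `c = 1`, 83 at `c = 3`, 0 failures (kit j312988/j313083/j313330); fails for EVEN `c` (class dies).
Why it might fail: step (ii)'s bookkeeping at `c ≠ 1` (certified only numerically for `c = 3`). [cite: Honda1968, Thm. 5]
[cite: SilvermanAEC2009, IV.1] -/
theorem Holds.stub_etaKummerTheta :
    ∀ (W₀ : WeierstrassCurve ℚ) [W₀.IsElliptic] [W₀.IsGloballyMinimal], IsOrdinaryAt W₀ 2 →
      ∀ (x₀ : ℚ), HasRationalTwoTorsionX W₀ x₀ → ¬ TwoTorsionRamifiedAtTwo x₀ →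
      ∀ (c : ℤ), Odd c →
      ∃ R : PowerSeries ℤ, PowerSeries.constantCoeff R = 1 ∧
        PowerSeries.map (Int.castRingHom ℚ) (kummerThetaSeries (W₀.conductorNorm ℤ)) *
            (W₀.formalXMulSq - PowerSeries.C x₀ * PowerSeries.X ^ 2).subst
              (W₀.formalExp.subst ((c : ℚ) • (PowerSeries.mk fun j : ℕ ↦ ((W₀.LFunction j : ℤ) : ℚ) / j))) =
          PowerSeries.map (Int.castRingHom ℚ) R ^ 2 :=
  KummerSigma.ThetaLaw.etaKummerTheta_of_apParityPattern Holds.stub_apParityPattern   -- v7.3: DERIVED from KA + landed kernels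


/-- STUB `stub_maninPrint` (PRINT — the conjunction of two NAMED FACTS of the tree, verbatim): Edixhoven 1991, Prop. 2 in lattice form
(`edixhoven_optimalManinConstant_integral`: `Λ₀ = q·Λ_f` exactly ⇒ `q ∈ ℤ`) and Abbes–Ullmo 1996, Thm. A
(`abbesUllmo_not_dvd_maninConstant_of_not_dvd_level`: `p ∤ N ⇒ p ∤ c` for an optimal datum; used at `p = 2`, `N` odd ⇒ `q` odd —
(★η) is false for even multiples).  Registered like `stub_ubd` / nsf's print stubs. [cite: EdixhovenManin1991, Prop. 2]
[cite: AbbesUllmo1996, Thm. A] -/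
theorem Holds.stub_maninPrint :
    edixhoven_optimalManinConstant_integral ∧ abbesUllmo_not_dvd_maninConstant_of_not_dvd_level := by
  sorry


/-! ### By-name handles of the five v7 stubs (needed before the v7 glue) -/

/-- By-name handle of stub K-D (v7). -/
def stub_dedekindEtaLog : Prop := type_of% Holds.stub_dedekindEtaLog

/-- By-name handle of stub K-U (v7). -/
def stub_etaSqrt : Prop := type_of% Holds.stub_etaSqrt

/-- By-name handle of stub KA (v7.3). -/
def stub_apParityPattern : Prop := type_of% Holds.stub_apParityPattern

/-- By-name handle of K-Θ (v7; derived since v7.3). -/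
def stub_etaKummerTheta : Prop := type_of% Holds.stub_etaKummerTheta

/-- By-name handle of the print stub `stub_maninPrint` (v7). -/
def stub_maninPrint : Prop := type_of% Holds.stub_maninPrint

/-- **v7 GLUE (lead star-p1 GEN 13, kernel-checked, no sorry): v6's research stub `stub_discrepancyCover` from the five v7 stubs.**
Clause (ii-b) — the discrepancy cover `Γ″ ≠ Γ₁(N)` carries a non-zero anti-invariant cusp form of some weight with an integral
multiple at `∞` — from K-D/K-U/K-Θ/K-A and the print stub `stub_maninPrint`, with the tree's engines: `q ∈ ℤ` (Edixhoven) and `q` odd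
(Abbes–Ullmo at `p = 2 ∤ N` through `ModularParametrizationData.exists_of_isNewformOf`), `2 ∤ N` (`stub_levelDetect`), `N ≥ 11`
(`cuspForm_two_gamma0_eq_zero_of_le_ten`), `IsOrdinaryAt W₀ 2` (Faltings `IsNewformOf.isIsogenous` + `isOrdinaryAt_of_isIsogenous`),
`g' ≠ 0` and cusp-evenness (`CuspEvenness.cover_clauses_of_curveData`), the square root of the `η`-quotient (K-U with K-D), (★η)_q (K-Θ at
`c = q`), `Z_q ∈ ℤ⟦q⟧` and its expansion (`ParamIntegral`, `ParamExpansion`), bounded denominators (`Gamma1Bounded`), and the assembly K-A.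
[cite: Mazur1977, II §16–§17] [cite: Stevens1982, §2.4–2.5] -/
theorem discrepancyCover_of :
    stub_dedekindEtaLog → stub_etaSqrt → stub_etaKummerTheta → stub_maninPrint →
    ∀ (W : WeierstrassCurve ℚ) [W.IsElliptic] [W.IsGloballyMinimal] (W₀ : WeierstrassCurve ℚ) [W₀.IsElliptic]
      [W₀.IsGloballyMinimal] ⦃N : ℕ⦄ [NeZero N] (f : CuspForm (Gamma0 N) 2), IsNewformOf W f → IsNewformOf W₀ f →
      IsOrdinaryAt W 2 → N = W.conductorNorm ℤ → W₀.conductorNorm ℤ = N →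
      ∀ (L₀ : PeriodPair), IsNeronLatticeOf (W₀.baseChange ℂ) L₀ → ∀ (q : ℚ), q ≠ 0 →
      (∀ z ∈ periodLattice f, (q : ℂ) * z ∈ L₀.lattice) → (∀ z ∈ L₀.lattice, ∃ w ∈ periodLattice f, z = (q : ℂ) * w) →
      ∀ (x₀ : ℚ), HasRationalTwoTorsionX W₀ x₀ → ¬ TwoTorsionRamifiedAtTwo x₀ →
      ∀ (lam : ℂ), lam ∈ L₀.lattice → lam / 2 ∉ L₀.lattice →
      L₀.weierstrassP (lam / 2) - ((W₀.b₂ : ℚ) : ℂ) / 12 = ((x₀ : ℚ) : ℂ) →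
      (∃ β : ℕ → ℕ, IsAdmissibleStabData (W.conductorNorm ℤ) β) →
      ∃ β : ℕ → ℕ, IsAdmissibleStabData (W.conductorNorm ℤ) β ∧ ∀ g' : ℚ,
        (∀ x : ℚ, (∃ γ : Gamma0 N,
          stabEisensteinPeriod (W.conductorNorm ℤ) β ((γ : SL(2, ℤ)) 0 0) ((γ : SL(2, ℤ)) 0 1)
            ((γ : SL(2, ℤ)) 1 0) ((γ : SL(2, ℤ)) 1 1) = x) ↔ ∃ n : ℤ, x = n * g') →
        (∀ Γ'' : Subgroup SL(2, ℤ),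
          (∀ γ : SL(2, ℤ), γ ∈ Γ'' ↔ ∃ hγ : γ ∈ Gamma0 N, γ ∈ Gamma1 N ∧
            ((∃ n : ℤ, stabEisensteinPeriod (W.conductorNorm ℤ) β (γ 0 0) (γ 0 1) (γ 1 0) (γ 1 1) = n * g' ∧ Even n) ↔
              ∃ k : ℤ, ∃ w ∈ L₀.lattice, (q : ℂ) * cuspSymbol f ⟨γ, hγ⟩ = (k : ℂ) * lam + 2 * w)) →
          (∃ γ₀ ∈ Gamma1 N, γ₀ ∉ Γ'') →
          ∃ (k : ℤ) (h : CuspForm Γ'' k) (M : ℕ),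
            (h : UpperHalfPlane → ℂ) ≠ 0 ∧
            (∀ γ ∈ Gamma1 N, γ ∉ Γ'' → (h : UpperHalfPlane → ℂ) ∣[k] γ = -h) ∧
            M ≠ 0 ∧
            ∀ n : ℕ, ∃ z : ℤ,
              PowerSeries.coeff n
                (UpperHalfPlane.qExpansion (1 : ℝ) (fun τ : UpperHalfPlane ↦ (M : ℂ) * h τ)) = (z : ℂ)) := by
  intro hKD hKU hKT hMP W _ _ W₀ _ _ N _ f hW hW₀ hord hN hN₀ L₀ hL₀ q hq hin hout x₀ hx₀ hnr lam hlam hlam2 hwp hβ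
  obtain ⟨β, hadm⟩ := hβ
  refine ⟨β, hadm, fun g' hg Γ'' hΓ _ ↦ ?_⟩
  -- the print named facts and Dedekind's functional equation (stubs K-D and `stub_maninPrint`)
  dsimp only [stub_dedekindEtaLog, stub_etaSqrt, stub_etaKummerTheta, stub_maninPrint] at hKD hKU hKT hMP
  obtain ⟨hEd, hAU⟩ := hMP
  have hDed := hKD
  -- `q ∈ ℤ` (Edixhoven 1991, Prop. 2, lattice form)
  obtain ⟨qz, hqz⟩ := hEd hW₀ hL₀ q hin hout
  subst hqz
  have hqz0 : qz ≠ 0 := by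
    rintro rfl
    exact hq (by simp)
  have hin' : ∀ z ∈ periodLattice f, (qz : ℂ) * z ∈ L₀.lattice := fun z hz ↦ by
    have h := hin z hz
    rwa [Rat.cast_intCast] at h
  have hout' : ∀ z ∈ L₀.lattice, ∃ w ∈ periodLattice f, z = (qz : ℂ) * w := fun z hz ↦ by
    obtain ⟨w, hw, h⟩ := hout z hz
    exact ⟨w, hw, by rwa [Rat.cast_intCast] at h⟩
  -- `N` is odd and at least `11`
  have h2N : ¬ 2 ∣ N :=
    (Summit.BirchSwinnertonDyer.BirchSwinnertonDyer.Theorems.EisensteinDepletionAtTwoStarOptBNSFStubLevelDetect.stub_levelDetect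
      W f hW).1 hord
  have h11 : 11 ≤ N := by
    by_contra hlt
    have hf0 : f = 0 := cuspForm_two_gamma0_eq_zero_of_le_ten (by omega) f
    have h1 : cuspCoeff f 1 = (W₀.LFunction 1 : ℂ) := hW₀.2 1
    rw [hf0, WeierstrassCurve.LFunction_apply_one] at h1
    have h0 : cuspCoeff (0 : CuspForm (Gamma0 N) 2) 1 = 0 :=
      (cuspCoeffₗ (one_mem_strictPeriods_coe_gamma0 N) 1).map_zero
    rw [h0] at h1
    norm_num at h1
  -- `q` is odd (Abbes–Ullmo 1996, Thm. A at `p = 2 ∤ N`, through a parametrisation datum with `(f, Λ₀, q)`)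
  obtain ⟨D', hD'f, hD'L, hD'c⟩ := ModularParametrizationData.exists_of_isNewformOf hW₀ hL₀ hqz0 hin'
  have hqodd : Odd qz := by
    have hopt : ∀ z ∈ D'.L.lattice, ∃ w ∈ periodLattice D'.f, z = (D'.c : ℂ) * w := by
      rw [hD'L, hD'f, hD'c]
      exact hout'
    have h2 := hAU W₀ D' hopt 2 Nat.prime_two h2N
    change ¬ ((2 : ℕ) : ℤ) ∣ D'.c at h2
    rw [hD'c, Nat.cast_ofNat] at h2
    exact Int.not_even_iff_odd.mp fun he ↦ h2 (even_iff_two_dvd.mp he)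
  -- level = conductor; ordinarity of the optimal curve (Faltings + isogeny transport)
  subst hN
  have hiso : WeierstrassCurve.IsIsogenous W W₀ :=
    IsNewformOf.isIsogenous WeierstrassCurve.isIsogenous_iff_frobeniusTrace_eq_holds hW hW₀
  have hord₀ : IsOrdinaryAt W₀ 2 :=
    Summit.BirchSwinnertonDyer.BirchSwinnertonDyer.Theorems.IsogenyMuShift.isOrdinaryAt_of_isIsogenous hiso hord
  -- clause (o) from the tree's cusp-evenness package: `g' ≠ 0`
  obtain ⟨hg0, hcusp, -⟩ :=
    Summit.BirchSwinnertonDyer.BirchSwinnertonDyer.Theorems.DepletionAtTwo.CuspEvenness.cover_clauses_of_curveData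
      W W₀ hord rfl hN₀ hx₀ hnr hadm hg
  -- (U) the square root of the Eisenstein `η`-quotient (stub K-U with stub K-D)
  obtain ⟨m, V, u, U, E, hud, hune, husq, humul, hUq, hE1, hUsq⟩ :=
    hKU (W.conductorNorm ℤ) β (Nat.odd_iff.mpr (Nat.two_dvd_ne_zero.mp h2N)) hadm g' hg hDed
  -- (Θ) the eta–Kummer square identity at `c = q` (stub K-Θ)
  obtain ⟨R, hR1, hR⟩ := hKT W₀ hord₀ x₀ hx₀ hnr qz hqodd
  rw [hN₀] at hR
  -- (Z) the integral expansion of the formal parameter (tree: Honda integrality + the analytic expansion)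
  choose kz hkz using
    Summit.BirchSwinnertonDyer.BirchSwinnertonDyer.Theorems.DepletionAtTwo.ParamIntegral.stub_paramIntegralFormal W₀ qz
  obtain ⟨-, -, A, hA⟩ :=
    Summit.BirchSwinnertonDyer.BirchSwinnertonDyer.Theorems.DepletionAtTwo.ParamExpansion.stub_paramExpansion
      W₀ f hW₀ L₀ hL₀ (qz : ℚ) (by exact_mod_cast hqz0)
  set zq : PowerSeries ℤ := PowerSeries.mk kz with hzqdef
  have hzq : PowerSeries.map (Int.castRingHom ℚ) zq =
      W₀.formalExp.subst ((qz : ℚ) • (PowerSeries.mk fun j : ℕ ↦ ((W₀.LFunction j : ℤ) : ℚ) / j)) := by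
    ext n
    rw [PowerSeries.coeff_map, hzqdef, PowerSeries.coeff_mk, eq_intCast, hkz n]
  have hzsum : ∃ A : ℝ, ∀ τ : UpperHalfPlane, A < τ.im →
      HasSum (fun n : ℕ ↦ ((PowerSeries.coeff n zq : ℤ) : ℂ) *
          Complex.exp (2 * Real.pi * Complex.I * (τ : ℂ)) ^ n)
        (-(L₀.weierstrassP ((qz : ℂ) * eichlerIntegral f τ) - ((W₀.b₂ : ℚ) : ℂ) / 12) /
          ((L₀.derivWeierstrassP ((qz : ℂ) * eichlerIntegral f τ)
            - ((W₀.a₁ : ℚ) : ℂ) * (L₀.weierstrassP ((qz : ℂ) * eichlerIntegral f τ) - ((W₀.b₂ : ℚ) : ℂ) / 12)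
            - ((W₀.a₃ : ℚ) : ℂ)) / 2)) := by
    refine ⟨A, fun τ hτ ↦ ?_⟩
    have hfun : (fun n : ℕ ↦ ((PowerSeries.coeff n zq : ℤ) : ℂ) * Complex.exp (2 * Real.pi * Complex.I * (τ : ℂ)) ^ n) =
        fun n : ℕ ↦ ((PowerSeries.coeff n (W₀.formalExp.subst
          ((qz : ℚ) • (PowerSeries.mk fun j : ℕ ↦ ((W₀.LFunction j : ℤ) : ℚ) / j))) : ℚ) : ℂ) *
            Complex.exp (2 * Real.pi * Complex.I * (τ : ℂ)) ^ n := by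
      funext n
      rw [hkz n, hzqdef, PowerSeries.coeff_mk, Rat.cast_intCast]
    rw [hfun]
    have h := hA τ hτ
    simp only [Rat.cast_intCast] at h
    exact h
  -- the Eisenstein periods of `Γ₁(N)` lie in `ℤ g'`
  have hper : ∀ γ : SL(2, ℤ), γ ∈ Gamma1 (W.conductorNorm ℤ) → ∃ n : ℤ,
      stabEisensteinPeriod (W.conductorNorm ℤ) β (γ 0 0) (γ 0 1) (γ 1 0) (γ 1 1) = n * g' :=
    fun γ hγ ↦ (hg _).mp ⟨⟨γ, Gamma1_in_Gamma0 _ hγ⟩, rfl⟩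
  -- the twisted group with the integer Manin constant
  have hΓ' : ∀ γ : SL(2, ℤ), γ ∈ Γ'' ↔ ∃ hγ : γ ∈ Gamma0 (W.conductorNorm ℤ), γ ∈ Gamma1 (W.conductorNorm ℤ) ∧
      ((∃ n : ℤ, stabEisensteinPeriod (W.conductorNorm ℤ) β (γ 0 0) (γ 0 1) (γ 1 0) (γ 1 1) = n * g' ∧ Even n) ↔
        ∃ k : ℤ, ∃ w ∈ L₀.lattice, (qz : ℂ) * cuspSymbol f ⟨γ, hγ⟩ = (k : ℂ) * lam + 2 * w) := by
    intro γ
    rw [hΓ γ]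
    simp only [Rat.cast_intCast]
  exact KummerSigma.kummerSqrtFormSigma_thetaLaw W₀ f hW₀ (by omega) L₀ hL₀ qz hqz0 hin' x₀ hx₀ lam hlam hlam2 hwp β g' hg0 hper
    hcusp Γ'' hΓ' m V u U E hud hune husq humul hUq hE1 hUsq R hR1 hR zq hzq hzsum
    (Summit.BirchSwinnertonDyer.BirchSwinnertonDyer.Theorems.DepletionAtTwo.Gamma1Bounded.stub_gamma1Bounded _ (by omega))

/-- v6's research stub 1b★★ `stub_discrepancyCover` — NO LONGER A STUB (v7): DERIVED by `discrepancyCover_of` from the five v7 stubs.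
Statement VERBATIM v6, so every v6 consumer below is untouched. [cite: Mazur1977, II §16–§17] [cite: Stevens1982, §2.4–2.5] -/
theorem Holds.stub_discrepancyCover :
    ∀ (W : WeierstrassCurve ℚ) [W.IsElliptic] [W.IsGloballyMinimal] (W₀ : WeierstrassCurve ℚ) [W₀.IsElliptic]
      [W₀.IsGloballyMinimal] ⦃N : ℕ⦄ [NeZero N] (f : CuspForm (Gamma0 N) 2), IsNewformOf W f → IsNewformOf W₀ f →
      IsOrdinaryAt W 2 → N = W.conductorNorm ℤ → W₀.conductorNorm ℤ = N →
      ∀ (L₀ : PeriodPair), IsNeronLatticeOf (W₀.baseChange ℂ) L₀ → ∀ (q : ℚ), q ≠ 0 →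
      (∀ z ∈ periodLattice f, (q : ℂ) * z ∈ L₀.lattice) → (∀ z ∈ L₀.lattice, ∃ w ∈ periodLattice f, z = (q : ℂ) * w) →
      ∀ (x₀ : ℚ), HasRationalTwoTorsionX W₀ x₀ → ¬ TwoTorsionRamifiedAtTwo x₀ →
      ∀ (lam : ℂ), lam ∈ L₀.lattice → lam / 2 ∉ L₀.lattice →
      L₀.weierstrassP (lam / 2) - ((W₀.b₂ : ℚ) : ℂ) / 12 = ((x₀ : ℚ) : ℂ) →
      (∃ β : ℕ → ℕ, IsAdmissibleStabData (W.conductorNorm ℤ) β) →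
      ∃ β : ℕ → ℕ, IsAdmissibleStabData (W.conductorNorm ℤ) β ∧ ∀ g' : ℚ,
        (∀ x : ℚ, (∃ γ : Gamma0 N,
          stabEisensteinPeriod (W.conductorNorm ℤ) β ((γ : SL(2, ℤ)) 0 0) ((γ : SL(2, ℤ)) 0 1)
            ((γ : SL(2, ℤ)) 1 0) ((γ : SL(2, ℤ)) 1 1) = x) ↔ ∃ n : ℤ, x = n * g') →
        (∀ Γ'' : Subgroup SL(2, ℤ),
          (∀ γ : SL(2, ℤ), γ ∈ Γ'' ↔ ∃ hγ : γ ∈ Gamma0 N, γ ∈ Gamma1 N ∧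
            ((∃ n : ℤ, stabEisensteinPeriod (W.conductorNorm ℤ) β (γ 0 0) (γ 0 1) (γ 1 0) (γ 1 1) = n * g' ∧ Even n) ↔
              ∃ k : ℤ, ∃ w ∈ L₀.lattice, (q : ℂ) * cuspSymbol f ⟨γ, hγ⟩ = (k : ℂ) * lam + 2 * w)) →
          (∃ γ₀ ∈ Gamma1 N, γ₀ ∉ Γ'') →
          ∃ (k : ℤ) (h : CuspForm Γ'' k) (M : ℕ),
            (h : UpperHalfPlane → ℂ) ≠ 0 ∧
            (∀ γ ∈ Gamma1 N, γ ∉ Γ'' → (h : UpperHalfPlane → ℂ) ∣[k] γ = -h) ∧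
            M ≠ 0 ∧
            ∀ n : ℕ, ∃ z : ℤ,
              PowerSeries.coeff n
                (UpperHalfPlane.qExpansion (1 : ℝ) (fun τ : UpperHalfPlane ↦ (M : ℂ) * h τ)) = (z : ℂ)) :=
  discrepancyCover_of Holds.stub_dedekindEtaLog Holds.stub_etaSqrt Holds.stub_etaKummerTheta Holds.stub_maninPrint

/-- STUB 1ᵘ `stub_ubd` (PRINT — the tree's NAMED FACT, verbatim): the unbounded denominators theorem of
Calegari–Dimitrov–Tang (J. Amer. Math. Soc. 38 (2025), Thm. 1.0.1), holomorphic-at-the-cusps case, as typed in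
`Literature/NumberTheory/Automorphic/UnboundedDenominators.lean`; registered like the route's print supports 20247 / 20274
(and like `stub_ubd` of line nsf v11/v12 on the sibling 27047).  [cite: CalegariDimitrovTang2025, Thm. 1.0.1] -/
theorem Holds.stub_ubd : Literature.NumberTheory.Automorphic.CalegariDimitrovTang2025_unboundedDenominators := by
  sorry


/-- STUB 2 `stub_kummerParityHom` (ELEMENTARY, size M — the Kummer parity of cusp symbols is multiplicative).  If
`q·Λ_f ⊆ Λ_{W₀}` and `λ ∈ Λ_{W₀}` with `λ/2 ∉ Λ_{W₀}`, then for `γ, δ ∈ Γ₀(N)`: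
`q·{∞,γδ∞} ∈ ℤλ + 2Λ_{W₀} ⟺ (q·{∞,γ∞} ∈ ℤλ + 2Λ_{W₀} ⟺ q·{∞,δ∞} ∈ ℤλ + 2Λ_{W₀})`.  Proof plan: Manin additivity
`cuspSymbol f (γδ) = cuspSymbol f γ + cuspSymbol f δ` (TREE `cuspSymbol_mul_holds`), both summands in `Λ_{W₀}`
(`cuspSymbol_mem_periodLattice` + the inclusion), and the index-2 count: `ℤλ + 2Λ_{W₀}` has index exactly `2` in the rank-2
lattice `Λ_{W₀}` because `λ ∉ 2Λ_{W₀}` (coordinates in `ω₁, ω₂`, `PeriodPair.mem_lattice`, `LinearIndependent.pair_iff`; cf.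
`halfLattice_not_all` of line `nsf`).  Why it might fail: it does not (folklore); the only trap is forgetting `λ ∉ 2Λ`.
[cite: Manin1972, §1.5–1.7] [cite: CremonaAlgorithms1997, §2.8, §2.10] -/
theorem Holds.stub_kummerParityHom :
    ∀ ⦃N : ℕ⦄ [NeZero N] (f : CuspForm (Gamma0 N) 2) (L₀ : PeriodPair) (q : ℚ),
      (∀ z ∈ periodLattice f, (q : ℂ) * z ∈ L₀.lattice) →
      ∀ (lam : ℂ), lam ∈ L₀.lattice → lam / 2 ∉ L₀.lattice →
      ∀ γ δ : Gamma0 N,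
        ((∃ k : ℤ, ∃ w ∈ L₀.lattice, (q : ℂ) * cuspSymbol f (γ * δ) = (k : ℂ) * lam + 2 * w) ↔
          ((∃ k : ℤ, ∃ w ∈ L₀.lattice, (q : ℂ) * cuspSymbol f γ = (k : ℂ) * lam + 2 * w) ↔
            (∃ k : ℤ, ∃ w ∈ L₀.lattice, (q : ℂ) * cuspSymbol f δ = (k : ℂ) * lam + 2 * w))) :=
  KummerStubs.stub_kummerParityHom   -- CLOSED in the tree (eng-2 GEN 16); kept as a named, discharged obligation

/-- STUB 3 `stub_characterOfGamma0` (CLOSED — `Theorems/EisensteinDepletionAtTwoStarGO2SigmaStubCharacterOfGamma0.lean`; ELEMENTARY, size M — a parity functional on `Γ₀(N)` that is multiplicative and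
trivial on the elements with `d ≡ 1 (mod N)` is a function of the entry `d`).  Proof plan: for `γ, γ' ∈ Γ₀(N)` with the
same `d`-entry, `(γ⁻¹γ')₂₂ = a d' − c b' ≡ ad ≡ 1 (mod N)` (as `N ∣ c`, `ad − bc = 1`), so `D(γ⁻¹γ') ` holds, and
multiplicativity (`D 1` from `D(1·1) ↔ (D 1 ↔ D 1)`, then `D γ⁻¹ ↔ D γ`) gives `D γ' ↔ D γ`; put
`e d := if (∃ γ, d(γ) = d ∧ ¬ D γ) then 1 else 0`.  Why it might fail: it does not; pure group theory of
`Γ₀(N)/Γ₁(N) ↪ (ℤ/N)ˣ`, `γ ↦ d mod N`. [cite: DiamondShurman2005, §1.2 (Γ₁(N) ⊴ Γ₀(N), (1.2.7))] -/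
theorem Holds.stub_characterOfGamma0 :
    ∀ (N : ℕ) (D : Gamma0 N → Prop),
      (∀ γ δ : Gamma0 N, D (γ * δ) ↔ (D γ ↔ D δ)) →
      (∀ γ : Gamma0 N, (N : ℤ) ∣ (γ : SL(2, ℤ)) 1 1 - 1 → D γ) →
      ∃ e : ℤ → ℤ, ∀ γ : Gamma0 N, D γ ↔ Even (e ((γ : SL(2, ℤ)) 1 1)) :=
  KummerStubs.stub_characterOfGamma0   -- CLOSED in the tree (eng-2 GEN 16); kept as a named obligation of the line

/-- STUB 4 `stub_levelEqConductor` (PRINT — v6: Carayol's «level = conductor» as the tree's NAMED FACT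
`IsNewformOf.level_eq_conductorNorm`, VERBATIM, at every level (v5 restricted it to the good-ordinary admissible regime of `W`; v6 needs it
for `W₀` as well).  In the tree: the squarefree case is PROVED (`IsNewformOf.level_eq_conductorNorm_of_squarefree`, Atkin–Lehner), the
general case from the modularity clause (`IsNewformOf.level_eq_conductorNorm_of_exists_conductorLevel`, strong multiplicity one) — which is how
the PARENT closer `DepletedLambdaLawAtTwoModNSF_of` below discharges it (item 27021 carries the modularity clause; this stub is needed only for
27046 BY NAME).  Why it might fail: it does not (Carayol 1986).  [cite: Carayol1986, Thm. (A)] [cite: DiamondShurman2005, Thm. 8.8.1] -/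
theorem Holds.stub_levelEqConductor : ∀ (N : ℕ) [NeZero N], IsNewformOf.level_eq_conductorNorm (N := N) := by
  sorry

/-- v5's research stub `stub_gammaOneCover` — now DERIVED (v6, no sorry): clauses (o), (ii-a), (iii) from the tree's cusp-evenness package
(`…CuspEvenness.cover_clauses_of_curveData`, p2 GEN 36; needs `W₀.conductorNorm ℤ = N`, from Carayol `stub_levelEqConductor` at `(W₀, f)`),
clause (ii-b) from `stub_discrepancyCover`.  Statement VERBATIM v5, so every v5 consumer below is untouched.
[cite: Stevens1982, §2.4–2.5] [cite: Carayol1986, Thm. (A)] [cite: Setzer1975, §2] -/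
theorem Holds.stub_gammaOneCover :
    ∀ (W : WeierstrassCurve ℚ) [W.IsElliptic] [W.IsGloballyMinimal] (W₀ : WeierstrassCurve ℚ) [W₀.IsElliptic]
      [W₀.IsGloballyMinimal] ⦃N : ℕ⦄ [NeZero N] (f : CuspForm (Gamma0 N) 2), IsNewformOf W f → IsNewformOf W₀ f →
      IsOrdinaryAt W 2 → N = W.conductorNorm ℤ →
      ∀ (L₀ : PeriodPair), IsNeronLatticeOf (W₀.baseChange ℂ) L₀ → ∀ (q : ℚ), q ≠ 0 →
      (∀ z ∈ periodLattice f, (q : ℂ) * z ∈ L₀.lattice) → (∀ z ∈ L₀.lattice, ∃ w ∈ periodLattice f, z = (q : ℂ) * w) →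
      ∀ (x₀ : ℚ), HasRationalTwoTorsionX W₀ x₀ → ¬ TwoTorsionRamifiedAtTwo x₀ →
      ∀ (lam : ℂ), lam ∈ L₀.lattice → lam / 2 ∉ L₀.lattice →
      L₀.weierstrassP (lam / 2) - ((W₀.b₂ : ℚ) : ℂ) / 12 = ((x₀ : ℚ) : ℂ) →
      (∃ β : ℕ → ℕ, IsAdmissibleStabData (W.conductorNorm ℤ) β) →
      ∃ β : ℕ → ℕ, IsAdmissibleStabData (W.conductorNorm ℤ) β ∧ ∀ g' : ℚ,
        (∀ x : ℚ, (∃ γ : Gamma0 N,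
          stabEisensteinPeriod (W.conductorNorm ℤ) β ((γ : SL(2, ℤ)) 0 0) ((γ : SL(2, ℤ)) 0 1)
            ((γ : SL(2, ℤ)) 1 0) ((γ : SL(2, ℤ)) 1 1) = x) ↔ ∃ n : ℤ, x = n * g') →
        g' ≠ 0 ∧
        (∀ γ : SL(2, ℤ), γ ∈ Gamma1 N → (γ : Matrix (Fin 2) (Fin 2) ℤ).trace = 2 →
          ∃ n : ℤ, stabEisensteinPeriod (W.conductorNorm ℤ) β (γ 0 0) (γ 0 1) (γ 1 0) (γ 1 1) = n * g' ∧ Even n) ∧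
        (∀ Γ'' : Subgroup SL(2, ℤ),
          (∀ γ : SL(2, ℤ), γ ∈ Γ'' ↔ ∃ hγ : γ ∈ Gamma0 N, γ ∈ Gamma1 N ∧
            ((∃ n : ℤ, stabEisensteinPeriod (W.conductorNorm ℤ) β (γ 0 0) (γ 0 1) (γ 1 0) (γ 1 1) = n * g' ∧ Even n) ↔
              ∃ k : ℤ, ∃ w ∈ L₀.lattice, (q : ℂ) * cuspSymbol f ⟨γ, hγ⟩ = (k : ℂ) * lam + 2 * w)) →
          (∃ γ₀ ∈ Gamma1 N, γ₀ ∉ Γ'') →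
          ∃ (k : ℤ) (h : CuspForm Γ'' k) (M : ℕ),
            (h : UpperHalfPlane → ℂ) ≠ 0 ∧
            (∀ γ ∈ Gamma1 N, γ ∉ Γ'' → (h : UpperHalfPlane → ℂ) ∣[k] γ = -h) ∧
            M ≠ 0 ∧
            ∀ n : ℕ, ∃ z : ℤ,
              PowerSeries.coeff n
                (UpperHalfPlane.qExpansion (1 : ℝ) (fun τ : UpperHalfPlane ↦ (M : ℂ) * h τ)) = (z : ℂ)) ∧
        (∃ b d : ℤ, 0 < d ∧ Int.gcd d (b * (W.conductorNorm ℤ : ℕ)) = 1 ∧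
          ∃ n' : ℤ, stabEisensteinPeriod (W.conductorNorm ℤ) β (Int.gcdA d (b * (W.conductorNorm ℤ : ℕ))) b
            (-((W.conductorNorm ℤ : ℕ) : ℤ) * Int.gcdB d (b * (W.conductorNorm ℤ : ℕ))) d = n' * g' ∧ Odd n') := by
  intro W _ _ W₀ _ _ N _ f hf hf₀ hord hN L₀ hL₀ q hq h₁ h₂ x₀ hx hnr lam hlam hlam₂ hP hβ
  have hN₀ : W₀.conductorNorm ℤ = N := ((Holds.stub_levelEqConductor N) hf₀).symm
  obtain ⟨β, hadm, hc⟩ := Holds.stub_discrepancyCover W W₀ f hf hf₀ hord hN hN₀ L₀ hL₀ q hq h₁ h₂ x₀ hx hnr lam hlam hlam₂ hP hβ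
  refine ⟨β, hadm, fun g' hg ↦ ?_⟩
  obtain ⟨ho, hiia, hiii⟩ :=
    Summit.BirchSwinnertonDyer.BirchSwinnertonDyer.Theorems.DepletionAtTwo.CuspEvenness.cover_clauses_of_curveData
      W W₀ hord hN hN₀ hx hnr hadm hg
  exact ⟨ho, hiia, hc g' hg, hiii⟩

/-! ### By-name handles (the audit admits a hypothesis of `StarGO2Sigma_of` only if its head constant is a registered
stub BY NAME) -/

/-- Statement of registered stub 1a (`Holds.stub_eisImageCyclic`), by name. -/
def stub_eisImageCyclic : Prop := type_of% Holds.stub_eisImageCyclic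

/-- Statement of registered stub 1b★ (`Holds.stub_gammaOneCover`), by name (v4). -/
def stub_gammaOneCover : Prop := type_of% Holds.stub_gammaOneCover

/-- Statement of registered stub 1b★★ (`Holds.stub_discrepancyCover`), by name (v6). -/
def stub_discrepancyCover : Prop := type_of% Holds.stub_discrepancyCover

/-- Statement of registered stub 1ᵘ (`Holds.stub_ubd`), by name (v4) — the tree's UBD named fact. -/
def stub_ubd : Prop := type_of% Holds.stub_ubd

/-- **v4 GLUE (lead star-p1 GEN 9, kernel-checked, no sorry): v3's research stub `stub_gammaOneParity` from the cover stub and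
unbounded denominators.**  For `γ ∈ Γ₁(N)` with `φ_β(γ) = n g'`: the discrepancy kernel `Γ″` exists
(`TwistedParityGroup.exists_twistedParityGroup`: `φ_β` additive on `Γ₀(N)` by the tree's `stabEisensteinPeriod_mul`, values in
`ℤg'` by the generator property); if `γ ∈ Γ″`, its membership is clause (ii) at `γ` (the integer `n` is unique as `g' ≠ 0`); if
`γ ∉ Γ″`, then `Γ″ ≠ Γ₁(N)`, (ii-b) gives `(h, M)`, (ii-a) + `cuspSymbol_eq_zero_of_discr_eq_zero` put every unipotent of
`Γ₁(N)` in `Γ″` (`mem_of_trace_eq_two_of_cuspEven`), `Γ″` has finite index (`finiteIndex_of_twistedParity`), and the congruence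
core IN EVERY WEIGHT (`CongruenceCore.false_of_antiinvariant_integral_cuspForm_wt`, lead GEN 10 p644813: UBD + Wohlfahrt PROVED +
`Γ₁ = ⟨Γ(N), T⟩`) is a contradiction. -/
theorem gammaOneParity_of_cover : stub_gammaOneCover → stub_ubd →
    ∀ (W : WeierstrassCurve ℚ) [W.IsElliptic] [W.IsGloballyMinimal] (W₀ : WeierstrassCurve ℚ) [W₀.IsElliptic]
      [W₀.IsGloballyMinimal] ⦃N : ℕ⦄ [NeZero N] (f : CuspForm (Gamma0 N) 2), IsNewformOf W f → IsNewformOf W₀ f →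
      IsOrdinaryAt W 2 → N = W.conductorNorm ℤ →
      ∀ (L₀ : PeriodPair), IsNeronLatticeOf (W₀.baseChange ℂ) L₀ → ∀ (q : ℚ), q ≠ 0 →
      (∀ z ∈ periodLattice f, (q : ℂ) * z ∈ L₀.lattice) → (∀ z ∈ L₀.lattice, ∃ w ∈ periodLattice f, z = (q : ℂ) * w) →
      ∀ (x₀ : ℚ), HasRationalTwoTorsionX W₀ x₀ → ¬ TwoTorsionRamifiedAtTwo x₀ →
      ∀ (lam : ℂ), lam ∈ L₀.lattice → lam / 2 ∉ L₀.lattice →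
      L₀.weierstrassP (lam / 2) - ((W₀.b₂ : ℚ) : ℂ) / 12 = ((x₀ : ℚ) : ℂ) →
      (∃ β : ℕ → ℕ, IsAdmissibleStabData (W.conductorNorm ℤ) β) →
      ∃ β : ℕ → ℕ, IsAdmissibleStabData (W.conductorNorm ℤ) β ∧ ∀ g' : ℚ,
        (∀ x : ℚ, (∃ γ : Gamma0 N,
          stabEisensteinPeriod (W.conductorNorm ℤ) β ((γ : SL(2, ℤ)) 0 0) ((γ : SL(2, ℤ)) 0 1)
            ((γ : SL(2, ℤ)) 1 0) ((γ : SL(2, ℤ)) 1 1) = x) ↔ ∃ n : ℤ, x = n * g') →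
        g' ≠ 0 ∧
        (∀ γ : Gamma0 N, (N : ℤ) ∣ (γ : SL(2, ℤ)) 1 1 - 1 → ∀ n : ℤ,
          stabEisensteinPeriod (W.conductorNorm ℤ) β ((γ : SL(2, ℤ)) 0 0) ((γ : SL(2, ℤ)) 0 1)
            ((γ : SL(2, ℤ)) 1 0) ((γ : SL(2, ℤ)) 1 1) = n * g' →
          (Even n ↔ ∃ k : ℤ, ∃ w ∈ L₀.lattice, (q : ℂ) * cuspSymbol f γ = (k : ℂ) * lam + 2 * w)) ∧
        (∃ b d : ℤ, 0 < d ∧ Int.gcd d (b * (W.conductorNorm ℤ : ℕ)) = 1 ∧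
          ∃ n' : ℤ, stabEisensteinPeriod (W.conductorNorm ℤ) β (Int.gcdA d (b * (W.conductorNorm ℤ : ℕ))) b
            (-((W.conductorNorm ℤ : ℕ) : ℤ) * Int.gcdB d (b * (W.conductorNorm ℤ : ℕ))) d = n' * g' ∧ Odd n') := by
  intro hC hU W _ _ W₀ _ _ N _ f hf hf₀ hord hN L₀ hL₀ q hq hin hout x₀ hx₀ hnr lam hlam hlam2 h℘ hβ
  dsimp only [stub_gammaOneCover, stub_ubd] at hC hU
  obtain ⟨β, hadm, H⟩ := hC W W₀ f hf hf₀ hord hN L₀ hL₀ q hq hin hout x₀ hx₀ hnr lam hlam hlam2 h℘ hβ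
  refine ⟨β, hadm, fun g' hg ↦ ?_⟩
  obtain ⟨hg0, hcusp, hcover, hbez⟩ := H g' hg
  refine ⟨hg0, ?_, hbez⟩
  intro γ hd n hn
  have hN0 : N ≠ 0 := NeZero.ne N
  -- `γ ∈ Γ₁(N)`: `c ≡ 0`, `d ≡ 1`, and `ad - bc = 1` gives `a ≡ 1`
  have hγ0 : (γ : SL(2, ℤ)) ∈ Gamma0 N := γ.2
  have hc : (((γ : SL(2, ℤ)) 1 0 : ℤ) : ZMod N) = 0 := Gamma0_mem.mp hγ0
  have hdZ : (((γ : SL(2, ℤ)) 1 1 : ℤ) : ZMod N) = 1 := by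
    have h := (ZMod.intCast_zmod_eq_zero_iff_dvd _ N).mpr hd
    rw [Int.cast_sub, Int.cast_one, sub_eq_zero] at h
    exact h
  have hγ1 : (γ : SL(2, ℤ)) ∈ Gamma1 N := by
    rw [Gamma1_mem]
    refine ⟨?_, hdZ, hc⟩
    have hdet : (γ : SL(2, ℤ)) 0 0 * (γ : SL(2, ℤ)) 1 1 - (γ : SL(2, ℤ)) 0 1 * (γ : SL(2, ℤ)) 1 0 = 1 := by
      have := Matrix.SpecialLinearGroup.det_coe (γ : SL(2, ℤ))
      rwa [Matrix.det_fin_two] at this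
    have h := congr_arg (fun z : ℤ ↦ (z : ZMod N)) hdet
    simp only [Int.cast_sub, Int.cast_mul, Int.cast_one, hdZ, hc, mul_one, mul_zero, sub_zero] at h
    exact h
  -- the additive Eisenstein period functional on `Γ₀(N)` with cyclic value group `ℤ·g'`
  subst hN
  have hdiv : ∀ δ : Gamma0 (W.conductorNorm ℤ), ((W.conductorNorm ℤ : ℕ) : ℤ) ∣ (δ : SL(2, ℤ)) 1 0 :=
    fun δ ↦ (ZMod.intCast_zmod_eq_zero_iff_dvd _ _).mp (Gamma0_mem.mp δ.2)
  have hφ : ∀ δ ε : Gamma0 (W.conductorNorm ℤ),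
      (fun δ : Gamma0 (W.conductorNorm ℤ) ↦ stabEisensteinPeriod (W.conductorNorm ℤ) β ((δ : SL(2, ℤ)) 0 0)
        ((δ : SL(2, ℤ)) 0 1) ((δ : SL(2, ℤ)) 1 0) ((δ : SL(2, ℤ)) 1 1)) (δ * ε) =
      (fun δ : Gamma0 (W.conductorNorm ℤ) ↦ stabEisensteinPeriod (W.conductorNorm ℤ) β ((δ : SL(2, ℤ)) 0 0)
        ((δ : SL(2, ℤ)) 0 1) ((δ : SL(2, ℤ)) 1 0) ((δ : SL(2, ℤ)) 1 1)) δ +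
      (fun δ : Gamma0 (W.conductorNorm ℤ) ↦ stabEisensteinPeriod (W.conductorNorm ℤ) β ((δ : SL(2, ℤ)) 0 0)
        ((δ : SL(2, ℤ)) 0 1) ((δ : SL(2, ℤ)) 1 0) ((δ : SL(2, ℤ)) 1 1)) ε :=
    fun δ ε ↦ stabEisensteinPeriod_mul (NeZero.ne _) hadm (hdiv δ) (hdiv ε)
  have hval : ∀ δ : Gamma0 (W.conductorNorm ℤ), ∃ m : ℤ,
      (fun δ : Gamma0 (W.conductorNorm ℤ) ↦ stabEisensteinPeriod (W.conductorNorm ℤ) β ((δ : SL(2, ℤ)) 0 0)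
        ((δ : SL(2, ℤ)) 0 1) ((δ : SL(2, ℤ)) 1 0) ((δ : SL(2, ℤ)) 1 1)) δ = m * g' :=
    fun δ ↦ (hg _).mp ⟨δ, rfl⟩
  have hin1 : ∀ z ∈ periodLatticeGamma1 f, (q : ℂ) * z ∈ L₀.lattice :=
    fun z hz ↦ hin z (periodLatticeGamma1_le_periodLattice f hz)
  obtain ⟨Γ'', hΓ⟩ := TwistedParityGroup.exists_twistedParityGroup f L₀ q hin1 hlam hlam2 _ hφ hg0 hval
  by_cases hmem : (γ : SL(2, ℤ)) ∈ Γ''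
  · -- membership IS clause (ii) at `γ`
    obtain ⟨hγ0', -, hM⟩ := (hΓ _).mp hmem
    have huniq : ∀ {m : ℤ}, stabEisensteinPeriod (W.conductorNorm ℤ) β ((γ : SL(2, ℤ)) 0 0) ((γ : SL(2, ℤ)) 0 1)
        ((γ : SL(2, ℤ)) 1 0) ((γ : SL(2, ℤ)) 1 1) = m * g' → m = n := by
      intro m hm
      have : (m : ℚ) = n := mul_right_cancel₀ hg0 (hm.symm.trans hn)
      exact_mod_cast this
    have hE : (∃ m : ℤ, stabEisensteinPeriod (W.conductorNorm ℤ) β ((γ : SL(2, ℤ)) 0 0) ((γ : SL(2, ℤ)) 0 1)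
        ((γ : SL(2, ℤ)) 1 0) ((γ : SL(2, ℤ)) 1 1) = m * g' ∧ Even m) ↔ Even n :=
      ⟨fun ⟨m, hm, he⟩ ↦ huniq hm ▸ he, fun he ↦ ⟨n, hn, he⟩⟩
    exact hE.symm.trans hM
  · -- otherwise the discrepancy cover exists and the congruence core refutes it
    exfalso
    haveI : Γ''.FiniteIndex :=
      TwistedParityGroup.finiteIndex_of_twistedParity f L₀ q hin1 hlam hlam2 _ hφ hg0 hval hΓ
    have hpar : ∀ γ' ∈ Gamma1 (W.conductorNorm ℤ), (γ' : Matrix (Fin 2) (Fin 2) ℤ).trace = 2 → γ' ∈ Γ'' :=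
      fun γ' hγ' htr ↦ TwistedParityGroup.mem_of_trace_eq_two_of_cuspEven f L₀ q
        (fun δ : Gamma0 (W.conductorNorm ℤ) ↦ stabEisensteinPeriod (W.conductorNorm ℤ) β ((δ : SL(2, ℤ)) 0 0)
          ((δ : SL(2, ℤ)) 0 1) ((δ : SL(2, ℤ)) 1 0) ((δ : SL(2, ℤ)) 1 1)) hΓ
        (fun γ'' _ hγ''1 htr'' ↦ hcusp γ'' hγ''1 htr'') hγ' htr
    obtain ⟨k, h, M, hh, hanti, hM, hint⟩ := hcover Γ'' hΓ ⟨γ, hγ1, hmem⟩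
    exact CongruenceCore.false_of_antiinvariant_integral_cuspForm_wt hU (NeZero.ne _) hpar
      ⟨γ, hγ1, hmem⟩ h hh hanti hM hint

/-- STUB 1b of v1–v3 `stub_gammaOneParity` — NO LONGER A STUB (v4): THEOREMS A+B in functional form, DERIVED from
`stub_gammaOneCover` and `stub_ubd` by `gammaOneParity_of_cover`.  (Statement unchanged, so every v3 consumer below —
`gammaOneLaw_of`, `starGO2SigmaLvl_of`, `DepletedLambdaLawAtTwoModNSF_of` — is untouched.)
[cite: Mazur1977, II §16–§17] [cite: Stevens1982, §2.4–2.5] [cite: CalegariDimitrovTang2025, Thm. 1.0.1] -/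
theorem Holds.stub_gammaOneParity :
    ∀ (W : WeierstrassCurve ℚ) [W.IsElliptic] [W.IsGloballyMinimal] (W₀ : WeierstrassCurve ℚ) [W₀.IsElliptic]
      [W₀.IsGloballyMinimal] ⦃N : ℕ⦄ [NeZero N] (f : CuspForm (Gamma0 N) 2), IsNewformOf W f → IsNewformOf W₀ f →
      IsOrdinaryAt W 2 → N = W.conductorNorm ℤ →
      ∀ (L₀ : PeriodPair), IsNeronLatticeOf (W₀.baseChange ℂ) L₀ → ∀ (q : ℚ), q ≠ 0 →
      (∀ z ∈ periodLattice f, (q : ℂ) * z ∈ L₀.lattice) → (∀ z ∈ L₀.lattice, ∃ w ∈ periodLattice f, z = (q : ℂ) * w) →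
      ∀ (x₀ : ℚ), HasRationalTwoTorsionX W₀ x₀ → ¬ TwoTorsionRamifiedAtTwo x₀ →
      ∀ (lam : ℂ), lam ∈ L₀.lattice → lam / 2 ∉ L₀.lattice →
      L₀.weierstrassP (lam / 2) - ((W₀.b₂ : ℚ) : ℂ) / 12 = ((x₀ : ℚ) : ℂ) →
      (∃ β : ℕ → ℕ, IsAdmissibleStabData (W.conductorNorm ℤ) β) →
      ∃ β : ℕ → ℕ, IsAdmissibleStabData (W.conductorNorm ℤ) β ∧ ∀ g' : ℚ,
        (∀ x : ℚ, (∃ γ : Gamma0 N,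
          stabEisensteinPeriod (W.conductorNorm ℤ) β ((γ : SL(2, ℤ)) 0 0) ((γ : SL(2, ℤ)) 0 1)
            ((γ : SL(2, ℤ)) 1 0) ((γ : SL(2, ℤ)) 1 1) = x) ↔ ∃ n : ℤ, x = n * g') →
        g' ≠ 0 ∧
        (∀ γ : Gamma0 N, (N : ℤ) ∣ (γ : SL(2, ℤ)) 1 1 - 1 → ∀ n : ℤ,
          stabEisensteinPeriod (W.conductorNorm ℤ) β ((γ : SL(2, ℤ)) 0 0) ((γ : SL(2, ℤ)) 0 1)
            ((γ : SL(2, ℤ)) 1 0) ((γ : SL(2, ℤ)) 1 1) = n * g' →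
          (Even n ↔ ∃ k : ℤ, ∃ w ∈ L₀.lattice, (q : ℂ) * cuspSymbol f γ = (k : ℂ) * lam + 2 * w)) ∧
        (∃ b d : ℤ, 0 < d ∧ Int.gcd d (b * (W.conductorNorm ℤ : ℕ)) = 1 ∧
          ∃ n' : ℤ, stabEisensteinPeriod (W.conductorNorm ℤ) β (Int.gcdA d (b * (W.conductorNorm ℤ : ℕ))) b
            (-((W.conductorNorm ℤ : ℕ) : ℤ) * Int.gcdB d (b * (W.conductorNorm ℤ : ℕ))) d = n' * g' ∧ Odd n') :=
  gammaOneParity_of_cover Holds.stub_gammaOneCover Holds.stub_ubd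

/-- Statement of registered stub 1b (`Holds.stub_gammaOneParity`), by name. -/
def stub_gammaOneParity : Prop := type_of% Holds.stub_gammaOneParity

/-- Statement of registered stub 2 (`Holds.stub_kummerParityHom`), by name. -/
def stub_kummerParityHom : Prop := type_of% Holds.stub_kummerParityHom

/-- Statement of registered stub 3 (`Holds.stub_characterOfGamma0`), by name. -/
def stub_characterOfGamma0 : Prop := type_of% Holds.stub_characterOfGamma0

/-- Statement of registered stub 4 (`Holds.stub_levelEqConductor`), by name. -/
def stub_levelEqConductor : Prop := type_of% Holds.stub_levelEqConductor

/-- **v6 GLUE (kernel-checked, no sorry): v5's cover statement from the three OPEN stubs** — (ii-b) from `stub_discrepancyCover`,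
`W₀.conductorNorm ℤ = N` from `stub_levelEqConductor` (Carayol at `(W₀, f)`), (o) + (ii-a) + (iii) from the tree (`cover_clauses_of_curveData`). -/
theorem gammaOneCover_of_cut : stub_levelEqConductor → stub_discrepancyCover → stub_gammaOneCover := by
  intro h4 hD W _ _ W₀ _ _ N _ f hf hf₀ hord hN L₀ hL₀ q hq h₁ h₂ x₀ hx hnr lam hlam hlam₂ hP hβ
  dsimp only [stub_levelEqConductor, stub_discrepancyCover] at h4 hD
  have hN₀ : W₀.conductorNorm ℤ = N := ((h4 N) hf₀).symm
  obtain ⟨β, hadm, hc⟩ := hD W W₀ f hf hf₀ hord hN hN₀ L₀ hL₀ q hq h₁ h₂ x₀ hx hnr lam hlam hlam₂ hP hβ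
  refine ⟨β, hadm, fun g' hg ↦ ?_⟩
  obtain ⟨ho, hiia, hiii⟩ :=
    Summit.BirchSwinnertonDyer.BirchSwinnertonDyer.Theorems.DepletionAtTwo.CuspEvenness.cover_clauses_of_curveData
      W W₀ hord hN hN₀ hx hnr hadm hg
  exact ⟨ho, hiia, hc g' hg, hiii⟩

/-! ### The bundled Γ₁-law (v1's registered stub 1, now DERIVED from stubs 1a + 1b) -/

/-- `GammaOneLaw` — the statement of v1's research stub `stub_gammaOneLaw` (2026-08-28T10:27Z registration): admissible
`β` and a scale `g' ≠ 0` with (i) `φ_β(Γ₀(N)) ⊆ ℤ·g'`, (ii) the parity law on `Γ₁(N)`, (iii) an odd Bézout value.  No longer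
a stub: it follows from `stub_eisImageCyclic` (take `g'` = the generator) and `stub_gammaOneParity` (`gammaOneLaw_of`).
[cite: Stevens1982, §2.4–2.5] -/
def GammaOneLaw : Prop :=
    ∀ (W : WeierstrassCurve ℚ) [W.IsElliptic] [W.IsGloballyMinimal] (W₀ : WeierstrassCurve ℚ) [W₀.IsElliptic]
      [W₀.IsGloballyMinimal] ⦃N : ℕ⦄ [NeZero N] (f : CuspForm (Gamma0 N) 2), IsNewformOf W f → IsNewformOf W₀ f →
      IsOrdinaryAt W 2 → N = W.conductorNorm ℤ →
      ∀ (L₀ : PeriodPair), IsNeronLatticeOf (W₀.baseChange ℂ) L₀ → ∀ (q : ℚ), q ≠ 0 →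
      (∀ z ∈ periodLattice f, (q : ℂ) * z ∈ L₀.lattice) → (∀ z ∈ L₀.lattice, ∃ w ∈ periodLattice f, z = (q : ℂ) * w) →
      ∀ (x₀ : ℚ), HasRationalTwoTorsionX W₀ x₀ → ¬ TwoTorsionRamifiedAtTwo x₀ →
      ∀ (lam : ℂ), lam ∈ L₀.lattice → lam / 2 ∉ L₀.lattice →
      L₀.weierstrassP (lam / 2) - ((W₀.b₂ : ℚ) : ℂ) / 12 = ((x₀ : ℚ) : ℂ) →
      (∃ β : ℕ → ℕ, IsAdmissibleStabData (W.conductorNorm ℤ) β) →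
      ∃ β : ℕ → ℕ, IsAdmissibleStabData (W.conductorNorm ℤ) β ∧ ∃ g' : ℚ, g' ≠ 0 ∧
        (∀ γ : Gamma0 N, ∃ n : ℤ,
          stabEisensteinPeriod (W.conductorNorm ℤ) β ((γ : SL(2, ℤ)) 0 0) ((γ : SL(2, ℤ)) 0 1)
            ((γ : SL(2, ℤ)) 1 0) ((γ : SL(2, ℤ)) 1 1) = n * g') ∧
        (∀ γ : Gamma0 N, (N : ℤ) ∣ (γ : SL(2, ℤ)) 1 1 - 1 → ∀ n : ℤ,
          stabEisensteinPeriod (W.conductorNorm ℤ) β ((γ : SL(2, ℤ)) 0 0) ((γ : SL(2, ℤ)) 0 1)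
            ((γ : SL(2, ℤ)) 1 0) ((γ : SL(2, ℤ)) 1 1) = n * g' →
          (Even n ↔ ∃ k : ℤ, ∃ w ∈ L₀.lattice, (q : ℂ) * cuspSymbol f γ = (k : ℂ) * lam + 2 * w)) ∧
        (∃ b d : ℤ, 0 < d ∧ Int.gcd d (b * (W.conductorNorm ℤ : ℕ)) = 1 ∧
          ∃ n' : ℤ, stabEisensteinPeriod (W.conductorNorm ℤ) β (Int.gcdA d (b * (W.conductorNorm ℤ : ℕ))) b
            (-((W.conductorNorm ℤ : ℕ) : ℤ) * Int.gcdB d (b * (W.conductorNorm ℤ : ℕ))) d = n' * g' ∧ Odd n')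

/-- v1's bundled law from the two new stubs: the generator of the cyclic period group (stub 1a) is the scale; stub 1b
gives `g' ≠ 0`, (ii) and (iii); (i) is the generator property itself. (kernel-checked, no sorry) -/
theorem gammaOneLaw_of : stub_gammaOneParity → GammaOneLaw := by
  intro hP W _ _ W₀ _ _ N _ f hf hf₀ hord hN L₀ hL₀ q hq hin hout x₀ hx₀ hnr lam hlam hlam2 h℘ hβ
  have hE : stub_eisImageCyclic := Holds.stub_eisImageCyclic   -- stub 1a: CLOSED in the tree, consumed here
  dsimp only [stub_eisImageCyclic, stub_gammaOneParity] at hE hP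
  obtain ⟨β, hadm, hP'⟩ := hP W W₀ f hf hf₀ hord hN L₀ hL₀ q hq hin hout x₀ hx₀ hnr lam hlam hlam2 h℘ hβ
  subst hN
  obtain ⟨g', hg⟩ := hE (W.conductorNorm ℤ) β (NeZero.ne _) hadm
  obtain ⟨hg0, hlaw, hodd⟩ := hP' g' hg
  refine ⟨β, hadm, g', hg0, ?_, hlaw, hodd⟩
  intro γ
  obtain ⟨n, hn⟩ := (hg _).mp ⟨γ, rfl⟩
  exact ⟨n, hn⟩

/-! ### The crux at level `N = N_W` (local statement: the crux body with the binder `N = W.conductorNorm ℤ`) -/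

/-- (★-GO₂^Σ) AT LEVEL = CONDUCTOR: the body of the route item `StarGO2Sigma` (27046) with the extra binder
`N = W.conductorNorm ℤ` after `IsOrdinaryAt W 2`.  This is the form the parent E1M_NSF consumes (its modularity clause
supplies the binder) and the form THEOREMS A+B address. [cite: Mazur1977, II §16–§17] [cite: Stevens1982, §2.4–2.5] -/
def StarGO2SigmaLvl : Prop :=
  ∀ (W : WeierstrassCurve ℚ) [W.IsElliptic] [W.IsGloballyMinimal] (W₀ : WeierstrassCurve ℚ) [W₀.IsElliptic]
    [W₀.IsGloballyMinimal] ⦃N : ℕ⦄ [NeZero N] (f : CuspForm (Gamma0 N) 2), IsNewformOf W f → IsNewformOf W₀ f →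
    IsOrdinaryAt W 2 → N = W.conductorNorm ℤ →
    ∀ (L₀ : PeriodPair), IsNeronLatticeOf (W₀.baseChange ℂ) L₀ → ∀ (q : ℚ), q ≠ 0 →
    (∀ z ∈ periodLattice f, (q : ℂ) * z ∈ L₀.lattice) → (∀ z ∈ L₀.lattice, ∃ w ∈ periodLattice f, z = (q : ℂ) * w) →
    ∀ (x₀ : ℚ), HasRationalTwoTorsionX W₀ x₀ → ¬ TwoTorsionRamifiedAtTwo x₀ →
    ∀ (lam : ℂ), lam ∈ L₀.lattice → lam / 2 ∉ L₀.lattice →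
    L₀.weierstrassP (lam / 2) - ((W₀.b₂ : ℚ) : ℂ) / 12 = ((x₀ : ℚ) : ℂ) →
    (∃ β : ℕ → ℕ, IsAdmissibleStabData (W.conductorNorm ℤ) β) →
    ∃ β : ℕ → ℕ, IsAdmissibleStabData (W.conductorNorm ℤ) β ∧ ∃ g' : ℚ, g' ≠ 0 ∧ ∃ e : ℤ → ℤ,
      (∀ b d : ℤ, 0 < d → Int.gcd d (b * (W.conductorNorm ℤ : ℕ)) = 1 →
        ∃ n' : ℤ, stabEisensteinPeriod (W.conductorNorm ℤ) β (Int.gcdA d (b * (W.conductorNorm ℤ : ℕ))) b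
          (-((W.conductorNorm ℤ : ℕ) : ℤ) * Int.gcdB d (b * (W.conductorNorm ℤ : ℕ))) d = n' * g' ∧
        (Even n' ↔ ((∃ k : ℤ, ∃ w ∈ L₀.lattice,
          (q : ℂ) * (modularSymbol f ((b : ℚ) / (d : ℚ)) - modularSymbol f 0) = (k : ℂ) * lam + 2 * w) ↔ Even (e d)))) ∧
      (∃ b d : ℤ, 0 < d ∧ Int.gcd d (b * (W.conductorNorm ℤ : ℕ)) = 1 ∧
        ∃ n' : ℤ, stabEisensteinPeriod (W.conductorNorm ℤ) β (Int.gcdA d (b * (W.conductorNorm ℤ : ℕ))) b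
          (-((W.conductorNorm ℤ : ℕ) : ℤ) * Int.gcdB d (b * (W.conductorNorm ℤ : ℕ))) d = n' * g' ∧ Odd n')

/-! ### Small propositional lemmas -/

/-- `↔` is associative-commutative: the multiplicativity of a XNOR of two multiplicative parities. [folklore] -/
theorem discrepancy_mul_aux {a b : ℤ} {Pa Pb Pab : Prop} (hP : Pab ↔ (Pa ↔ Pb)) :
    (Even (a + b) ↔ Pab) ↔ ((Even a ↔ Pa) ↔ (Even b ↔ Pb)) := by
  rw [Int.even_add]
  tauto

/-- Re-association of `↔`. [folklore] -/
theorem iff_rotate_aux {A B C : Prop} (h : (A ↔ B) ↔ C) : A ↔ (B ↔ C) := by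
  tauto

/-! ### Composition 1: the three real stubs give the crux at level `N = N_W` (kernel-checked, no sorry) -/

/-- COMPOSITION (kernel-checked): stubs 1–3 give (★-GO₂^Σ) at level `N = N_W`.  The discrepancy
`D γ := (φ_β(γ)/g' even ↔ q·cuspSymbol f γ ∈ ℤλ + 2Λ_{W₀})` is multiplicative on `Γ₀(N)` (stub 1 (i) + TREE
`stabEisensteinPeriod_mul` + stub 2) and holds on `Γ₁(N)` (stub 1 (ii)), so it is `Even (e d)` (stub 3); at the Bézout
matrix `γ_{b,d}` this is the cusp clause (TREE `modularSymbol_gamma0_smul_holds` at `r = 0`). [cite: Stevens1982, §2.5]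
[cite: Manin1972, §1.5–1.7] -/
theorem starGO2SigmaLvl_of :
    stub_gammaOneParity → StarGO2SigmaLvl := by
  intro hP W _ _ W₀ _ _ N _ f hf hf₀ hord hN L₀ hL₀ q hq hin hout x₀ hx₀ hnr lam hlam hlam2 h℘ hβ
  have h1 : GammaOneLaw := gammaOneLaw_of hP
  have h3 : stub_kummerParityHom := Holds.stub_kummerParityHom       -- stub 2: CLOSED in the tree, consumed here
  have h2 : stub_characterOfGamma0 := Holds.stub_characterOfGamma0   -- stub 3: CLOSED in the tree, consumed here
  dsimp only [GammaOneLaw, stub_kummerParityHom, stub_characterOfGamma0] at h1 h3 h2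
  obtain ⟨β, hadm, g', hg', hint, hlaw, hodd⟩ :=
    h1 W W₀ f hf hf₀ hord hN L₀ hL₀ q hq hin hout x₀ hx₀ hnr lam hlam hlam2 h℘ hβ
  refine ⟨β, hadm, g', hg', ?_⟩
  subst hN
  -- opaque names for the Eisenstein value, the symbol parity and the discrepancy
  obtain ⟨φ, hφ⟩ : ∃ φ : Gamma0 (W.conductorNorm ℤ) → ℚ, ∀ γ, φ γ =
      stabEisensteinPeriod (W.conductorNorm ℤ) β ((γ : SL(2, ℤ)) 0 0) ((γ : SL(2, ℤ)) 0 1) ((γ : SL(2, ℤ)) 1 0) ((γ : SL(2, ℤ)) 1 1) :=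
    ⟨_, fun _ ↦ rfl⟩
  obtain ⟨P, hP⟩ : ∃ P : Gamma0 (W.conductorNorm ℤ) → Prop, ∀ γ, P γ ↔
      ∃ k : ℤ, ∃ w ∈ L₀.lattice, (q : ℂ) * cuspSymbol f γ = (k : ℂ) * lam + 2 * w :=
    ⟨_, fun _ ↦ Iff.rfl⟩
  obtain ⟨D, hDdef⟩ : ∃ D : Gamma0 (W.conductorNorm ℤ) → Prop, ∀ γ, D γ ↔ ∃ n : ℤ, φ γ = n * g' ∧ (Even n ↔ P γ) :=
    ⟨_, fun _ ↦ Iff.rfl⟩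
  have hint' : ∀ γ : Gamma0 (W.conductorNorm ℤ), ∃ n : ℤ, φ γ = n * g' := fun γ ↦ by rw [hφ]; exact hint γ
  have hlaw' : ∀ γ : Gamma0 (W.conductorNorm ℤ), ((W.conductorNorm ℤ : ℕ) : ℤ) ∣ (γ : SL(2, ℤ)) 1 1 - 1 → ∀ n : ℤ, φ γ = n * g' → (Even n ↔ P γ) := by
    intro γ hγ n hn
    rw [hP]
    rw [hφ] at hn
    exact hlaw γ hγ n hn
  have hD : ∀ (γ : Gamma0 (W.conductorNorm ℤ)) (n₀ : ℤ), φ γ = n₀ * g' → (D γ ↔ (Even n₀ ↔ P γ)) := by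
    intro γ n₀ h0
    rw [hDdef]
    constructor
    · rintro ⟨n, hn, hiff⟩
      have hnn : (n : ℚ) = n₀ := mul_right_cancel₀ hg' (hn.symm.trans h0)
      have hnn' : n = n₀ := by exact_mod_cast hnn
      rw [← hnn']
      exact hiff
    · intro hiff
      exact ⟨n₀, h0, hiff⟩
  -- additivity of the Eisenstein side on Γ₀(N) (TREE)
  have hN0 : W.conductorNorm ℤ ≠ 0 := NeZero.ne _
  have hmemN : ∀ γ : Gamma0 (W.conductorNorm ℤ), ((W.conductorNorm ℤ : ℕ) : ℤ) ∣ (γ : SL(2, ℤ)) 1 0 := fun γ ↦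
    (ZMod.intCast_zmod_eq_zero_iff_dvd _ _).mp (Gamma0_mem.mp γ.2)
  have hadd : ∀ γ δ : Gamma0 (W.conductorNorm ℤ), φ (γ * δ) = φ γ + φ δ := by
    intro γ δ
    rw [hφ, hφ, hφ, Subgroup.coe_mul]
    exact stabEisensteinPeriod_mul hN0 hadm (hmemN γ) (hmemN δ)
  -- multiplicativity of the symbol parity (stub 2) and of the discrepancy
  have hPmul : ∀ γ δ : Gamma0 (W.conductorNorm ℤ), P (γ * δ) ↔ (P γ ↔ P δ) := by
    intro γ δ
    rw [hP, hP, hP]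
    exact h3 f L₀ q hin lam hlam hlam2 γ δ
  have hDmul : ∀ γ δ : Gamma0 (W.conductorNorm ℤ), D (γ * δ) ↔ (D γ ↔ D δ) := by
    intro γ δ
    obtain ⟨a, ha⟩ := hint' γ
    obtain ⟨b, hb⟩ := hint' δ
    have hab : φ (γ * δ) = ((a + b : ℤ) : ℚ) * g' := by
      rw [hadd, ha, hb]
      push_cast
      ring
    rw [hD _ _ hab, hD _ _ ha, hD _ _ hb]
    exact discrepancy_mul_aux (hPmul γ δ)
  have hDone : ∀ γ : Gamma0 (W.conductorNorm ℤ), ((W.conductorNorm ℤ : ℕ) : ℤ) ∣ (γ : SL(2, ℤ)) 1 1 - 1 → D γ := by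
    intro γ hγ
    obtain ⟨n, hn⟩ := hint' γ
    exact (hD γ n hn).mpr (hlaw' γ hγ n hn)
  -- the character (stub 3)
  obtain ⟨e, he⟩ := h2 (W.conductorNorm ℤ) D hDmul hDone
  refine ⟨e, ?_, hodd⟩
  intro b d hd hgcd
  -- the Bézout matrix of the cusp b/d as an element of Γ₀(N)
  have hbez : ((Int.gcd d (b * (W.conductorNorm ℤ : ℕ)) : ℕ) : ℤ) =
      d * Int.gcdA d (b * (W.conductorNorm ℤ : ℕ)) + b * (W.conductorNorm ℤ : ℕ) * Int.gcdB d (b * (W.conductorNorm ℤ : ℕ)) :=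
    Int.gcd_eq_gcd_ab d (b * (W.conductorNorm ℤ : ℕ))
  rw [hgcd] at hbez
  push_cast at hbez
  have hdet : Matrix.det !![Int.gcdA d (b * (W.conductorNorm ℤ : ℕ)), b; -((W.conductorNorm ℤ : ℕ) : ℤ) * Int.gcdB d (b * (W.conductorNorm ℤ : ℕ)), d] = 1 := by
    rw [Matrix.det_fin_two_of]
    linear_combination -hbez
  set M : SL(2, ℤ) := ⟨!![Int.gcdA d (b * (W.conductorNorm ℤ : ℕ)), b; -((W.conductorNorm ℤ : ℕ) : ℤ) * Int.gcdB d (b * (W.conductorNorm ℤ : ℕ)), d], hdet⟩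
    with hM
  have e00 : M 0 0 = Int.gcdA d (b * (W.conductorNorm ℤ : ℕ)) := rfl
  have e01 : M 0 1 = b := rfl
  have e10 : M 1 0 = -((W.conductorNorm ℤ : ℕ) : ℤ) * Int.gcdB d (b * (W.conductorNorm ℤ : ℕ)) := rfl
  have e11 : M 1 1 = d := rfl
  have hMmem : M ∈ Gamma0 (W.conductorNorm ℤ) := by
    rw [Gamma0_mem, ZMod.intCast_zmod_eq_zero_iff_dvd, e10]
    exact ⟨-Int.gcdB d (b * (W.conductorNorm ℤ : ℕ)), by ring⟩
  set γ₀ : Gamma0 (W.conductorNorm ℤ) := ⟨M, hMmem⟩ with hγ₀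
  have hcoe : (γ₀ : SL(2, ℤ)) = M := rfl
  -- the Eisenstein value at γ₀
  obtain ⟨n', hn'⟩ := hint' γ₀
  have hn'' : stabEisensteinPeriod (W.conductorNorm ℤ) β (Int.gcdA d (b * (W.conductorNorm ℤ : ℕ))) b (-((W.conductorNorm ℤ : ℕ) : ℤ) * Int.gcdB d (b * (W.conductorNorm ℤ : ℕ))) d =
      n' * g' := by
    have h := hn'
    rw [hφ, hcoe, e00, e01, e10, e11] at h
    exact h
  refine ⟨n', hn'', ?_⟩
  -- the symbol value at γ₀ : cuspSymbol f γ₀ = {∞, b/d} - {∞, 0}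
  have hr : (((γ₀ : SL(2, ℤ)) 1 0 : ℤ) : ℚ) * 0 + (((γ₀ : SL(2, ℤ)) 1 1 : ℤ) : ℚ) ≠ 0 := by
    rw [hcoe, e11, mul_zero, zero_add]
    exact_mod_cast hd.ne'
  have hsm := modularSymbol_gamma0_smul_holds f γ₀ 0 hr
  rw [hcoe, e00, e01, e10, e11, mul_zero, zero_add, mul_zero, zero_add] at hsm
  have hcs : cuspSymbol f γ₀ = modularSymbol f ((b : ℚ) / (d : ℚ)) - modularSymbol f 0 := by
    rw [hsm]
    ring
  -- assemble
  have key : (Even n' ↔ P γ₀) ↔ Even (e d) := by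
    rw [← hD γ₀ n' hn']
    have h := he γ₀
    rw [hcoe, e11] at h
    exact h
  rw [hP, hcs] at key
  exact iff_rotate_aux key

/-! ### Composition 2: the crux BY NAME (adds stub 4 = level = conductor) -/

/-- COMPOSITION (kernel-checked, no sorry; v7: seven stubs): the stubs give the route item `StarGO2Sigma` (27046) BY NAME.
[cite: Stevens1982, §2.5] [cite: Carayol1986, Thm. (A)] -/
theorem StarGO2Sigma_of :
    stub_levelEqConductor → stub_dedekindEtaLog → stub_etaSqrt →
    stub_maninPrint → stub_ubd →
    Summit.BirchSwinnertonDyer.BirchSwinnertonDyer.Theses.EisensteinDepletionAtTwo.StarGO2Sigma := by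
  intro h4 hKD hKU hMP hU W _ _ W₀ _ _ N _ f hf hf₀ hord L₀ hL₀ q hq hin hout x₀ hx₀ hnr lam hlam hlam2 h℘ hβ
  have hKT : stub_etaKummerTheta := Holds.stub_etaKummerTheta   -- K-Θ: DERIVED from KA (CLOSED, p673866) and the landed kernels
  have hD : stub_discrepancyCover := discrepancyCover_of hKD hKU hKT hMP   -- v7.2 glue (K-A′ = tree theorem)
  have hC : stub_gammaOneCover := gammaOneCover_of_cut h4 hD          -- v6 glue
  have hP : stub_gammaOneParity := gammaOneParity_of_cover hC hU   -- v4 glue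
  dsimp only [stub_levelEqConductor] at h4
  exact starGO2SigmaLvl_of hP W W₀ f hf hf₀ hord ((h4 N) hf) L₀ hL₀ q hq hin hout x₀ hx₀ hnr lam
    hlam hlam2 h℘ hβ

/-- The crux from the stubs (v4: sorried exactly at the three OPEN `Holds.stub_*`: `stub_gammaOneCover`, `stub_ubd`, `stub_levelEqConductor`). -/
theorem starGO2Sigma_kummer :
    Summit.BirchSwinnertonDyer.BirchSwinnertonDyer.Theses.EisensteinDepletionAtTwo.StarGO2Sigma :=
  StarGO2Sigma_of Holds.stub_levelEqConductor Holds.stub_dedekindEtaLog Holds.stub_etaSqrt Holds.stub_maninPrint Holds.stub_ubd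

/-- v3's 2-ary composition, kept for the record (bookkeeping; `stub_gammaOneParity` is derived in v4), as a `Prop` (v6: wrapped
in a def so that only the registered composition `StarGO2Sigma_of` concludes the crux by name — the skeleton checker takes an
ARBITRARY crux-concluding theorem of the file). -/
def StarGO2SigmaOfParity : Prop :=
    stub_levelEqConductor → stub_gammaOneParity →
    Summit.BirchSwinnertonDyer.BirchSwinnertonDyer.Theses.EisensteinDepletionAtTwo.StarGO2Sigma

/-- Proof of `StarGO2SigmaOfParity` (v3's composition). -/
theorem starGO2Sigma_of_parity : StarGO2SigmaOfParity := by
  intro h4 hP W _ _ W₀ _ _ N _ f hf hf₀ hord L₀ hL₀ q hq hin hout x₀ hx₀ hnr lam hlam hlam2 h℘ hβ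
  dsimp only [stub_levelEqConductor] at h4
  exact starGO2SigmaLvl_of hP W W₀ f hf hf₀ hord ((h4 N) hf) L₀ hL₀ q hq hin hout x₀ hx₀ hnr lam
    hlam hlam2 h℘ hβ

/-! ### Composition 3: the split PARENT E1M_NSF (item 27021) WITHOUT stub 4 -/

/-- COMPOSITION (kernel-checked, no sorry): stubs 1–3 and the sibling child `StarOptBNSF` (item 27047) give the split
parent `DepletedLambdaLawAtTwoModNSF` (item 27021) BY NAME — Carayol-free: the parent's modularity clause gives
`N = N_W` (TREE `IsNewformOf.level_eq_conductorNorm_of_exists_conductorLevel`), then the pointwise glue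
`depletedLambdaLawAtTwoAt_of_star` (p619642) exactly as in `depletedLambdaLawAtTwoModNSF_of_starNSF` (p622375).
[cite: GreenbergVatsal2000, §3 Thm. (3.12), display (28)] [cite: DiamondShurman2005, Thm. 8.8.1] -/
theorem DepletedLambdaLawAtTwoModNSF_of :
    stub_discrepancyCover → stub_ubd →
    Summit.BirchSwinnertonDyer.BirchSwinnertonDyer.Theses.EisensteinDepletionAtTwo.StarOptBNSF →
    Summit.BirchSwinnertonDyer.BirchSwinnertonDyer.Theses.EisensteinDepletionAtTwo.DepletedLambdaLawAtTwoModNSF := by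
  intro hD hU hO hMod W _ _ x hord hx hAB hnsf N _ f hf c L hL hι S hS hSN
  -- v6: Carayol for EVERY curve from the parent's modularity clause (strong multiplicity one, tree), so no print stub is used here
  have h4 : stub_levelEqConductor := fun N' _ V _ g hg ↦ by
    haveI : NeZero (V.conductorNorm ℤ) := ⟨(WeierstrassCurve.conductorNorm_pos_holds V).ne'⟩
    exact IsNewformOf.level_eq_conductorNorm_of_exists_conductorLevel (hMod V) hg
  have hP : stub_gammaOneParity := gammaOneParity_of_cover (gammaOneCover_of_cut h4 hD) hU
  have lvl := starGO2SigmaLvl_of hP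
  haveI : NeZero (W.conductorNorm ℤ) := ⟨(WeierstrassCurve.conductorNorm_pos_holds W).ne'⟩
  have hlevel : ∀ ⦃N' : ℕ⦄ [NeZero N'] (f' : CuspForm (Gamma0 N') 2), IsNewformOf W f' → N' = W.conductorNorm ℤ :=
    fun N' _ f' hf' ↦ IsNewformOf.level_eq_conductorNorm_of_exists_conductorLevel (hMod W) hf'
  exact depletedLambdaLawAtTwoAt_of_star W
    (fun W₀ _ _ N' _ f' hf' hf₀' hord' ↦ lvl W W₀ f' hf' hf₀' hord' (hlevel f' hf'))
    (fun x hord hx hAB h15 ↦ hO W x hord hx hAB h15 hnsf) x hord hx hAB f hf c L hL hι S hS hSN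

end Summit.BirchSwinnertonDyer.BirchSwinnertonDyer.Cruxes.StarGO2Sigma.Kummer
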